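import Summits.HodgeConjecture.HodgeConjecture.Cruxes.BlochSeedDiscOne.SeedChecker
import Summits.Ventures.HSemireg.AmplificationChainAssembly
import Literature.AlgebraicGeometry.HodgeTheory.SemiregularVariationalHodgeISemiregularCoherent
import Literature.AlgebraicGeometry.HodgeTheory.ChernCharacterCoherent
import Literature.AlgebraicGeometry.HodgeTheory.HomComplexSigmaWindow
import Literature.AlgebraicGeometry.HodgeTheory.HomComplexSigmaDinatural
import Literature.AlgebraicGeometry.Modules.VectorBundleFiniteLocallyFree
import Literature.AlgebraicGeometry.Motives.ChernClassesProofs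
import HarnessLib

/-!
# Seed checker v19 (hsemireg-c5c8-1 g18, 2026-08-30; + v20 §20, g19) — ADDITIVE satellite of `SeedChecker.lean` v4: THE COHERENT
# (WINDOW-FORM) SHEAF DOOR — C5–C8 for a presentation by a COHERENT sheaf given with a finite locally free resolution,
# wired BY NAME to the REFEREED coherent rendering of Buchweitz–Flenner 2003, Thm. 5.1

Crux workfile for `stmt-HodgeConjecture-18881` (`BlochSeedDiscOne := HasHyperbolicBlochSeed 4 1`, route
`EightfoldBlochSeeds`); token of record
`line stmt-HodgeConjecture-18881 Cruxes/BlochSeedDiscOne/Lines/birth.lean 814a6a70c14e831a stub_rung_pad4_seedAt`.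

HONEST FRAMING. Definitions (predicates), one named LAW (a `Prop`, consumed by name, never asserted) and PROVED
repackaging ∕ composition lemmas. NOTHING here is a rung: no seed is exhibited, no design is certified, no sheaf is shown
semiregular, and NOTHING HERE SAYS THAT HC ∕ HC_CM ∕ HC_AV ∕ №4 ∕ 26512 ∕ 18881 ∕ H2 holds or fails. The coherent door
reaches the SAME LEAF as the lci Bloch door of 18881 (`HasLocallyAlgebraicWeilAnchor 4 1`, whence the rung-H2 leaf
`SevenfoldWeilCensus.WeilSixfolds` through `weilSixfolds_of_reach_of_localAnchor_four`) — it does NOT imply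
`BlochSeedDiscOne` as typed (an lci Bloch seed) and is not a proof of, or toward, item 18881. 0 `sorry`, no `instance`, no
`notation`, no attribute games, no `allowUnsafeReducibility`.

## Why v19 (what was missing after v4–v18)

v4's sheaf-door checker `Design.SheafSeedCheck` (and its rank-free ∕ window variants of v5 `SeedCheckerPorteous`) reads
the presentation as a FINITE LOCALLY FREE `𝓔` (caveat C1 of `Summits/Ventures/HSemireg/SheafSeedOnAnchor.lean`): its
semiregularity clause is the module-level `IsISemiregular h𝓔 _` (local-frame trace through `𝓔^∨∨ ⊗ Ω^q`, which is NOT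
Buchweitz–Flenner's `σ` for a sheaf that is not a vector bundle) and its class clause reads `C.ch X 𝓔 p` — a value the
axioms of `ChernCharacterBetti` constrain ONLY on vector bundles (FLAG F19-1 below). Meanwhile the presentations the cell
actually meets are often NOT vector bundles: monads with a degenerate map (`Cruxes/BlochSeedDiscOne/B3-DEEP-ALPHA-monad4-g10.md`:
on T40 ∕ H40 the display sheaf `E = ker q ∕ im i` is never locally free, `coker q ≠ 0` in codimension exactly `5`),
reflexive non-locally-free sheaves (the secant-sheaf road), torsion sheaves on sub-tori (`TorusCarrierSheafDoor.lean`).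
Since 2026-08-2x the tree holds (a) the REFEREED coherent rendering of BF Thm. 5.1,
`BuchweitzFlenner2003_variationalHodge_ISemiregular_coherent` (seed = an `𝒪_{X₀}`-module `ℰ₀` GIVEN WITH a strictly perfect
resolution `R`, `I`-semiregular as the perfect complex `R.P` — `HomComplex.IsISemiregularC` — with Chern character
`chPerfect C X₀ R.P`), (b) `chCoh C X F R k` = the Chern character of a coherent sheaf on a resolution
(`ChernCharacterCoherent.lean`, additivity on short exact sequences of coherent sheaves on an abelian variety under
Hartshorne III Ex. 6.9 (b): `AbelianVariety.chCoh_shortExact`), and (c) the door-agnostic object-class currency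
`ObjClass ∕ LocalVariationalHodgeFor ∕ HasSeedOn ∕ HasHyperbolicSeedOn` of `AmplificationChainAssembly.lean` — but NO object
class for (a) and no checker reading a coherent presentation. v19 supplies exactly that, additively.

## Contents (namespace `Summit.HodgeConjecture.HodgeConjecture.Cruxes.BlochSeedDiscOne.SeedChecker`, as v4–v18)

§19.1 THE COHERENT OBJECT CLASS AND ITS REFEREED DOOR (any `X₀ : SchemeOver ℂ`).
* `IsBFSemiregularVia X₀ R I` — BF `I`-semiregularity of `ℰ₀` READ ON the resolution `R` (Chern-degree window `I`:
  `(σ_q)_{q+1 ∈ I}` jointly injective on `Hom_{D(X₀)}(R.P, R.P[2]) = Ext²(ℰ₀, ℰ₀)`), VERBATIM the hypothesis of the refereed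
  fact; `cohSheafClass C : ObjClass` — «`κ|_I = ch(ℰ₀)|_I` for such an `ℰ₀`».
* PROVED: `localVariationalHodgeFor_cohSheafClass` — BF Thm. 5.1 (coherent) IS `LocalVariationalHodgeFor (cohSheafClass C)`
  (binder shuffle, as `localVariationalHodgeFor_bfSheafClass`); `cohSheafClass_of_bfSheafClass` — every BF vector-bundle
  seed is a coherent seed (`R := ℰ₀[0]`, `HomComplex.isISemiregularC_single₀_iff`, `chCoh_ofFiniteLocallyFree`): C1 IS
  LIFTED; hence `localVariationalHodgeFor_bfSheafClass_of_coherent` and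
  `hasLocallyAlgebraicWeilAnchor_of_BFcoherent_of_hyperbolicSeedOn : BF-coherent → HasHyperbolicSeedOn (cohSheafClass C) N d →
  HasLocallyAlgebraicWeilAnchor N d`.
§19.2 THE PAD-4 MEMBER FORM `CoherentSheafSeedPad4 C` (verbatim STUB R of `Lines/birth.lean` ∕ `TorusCarrierSheafSeedPad4`
  with the seed clause `HasSeedOn (cohSheafClass C) 4 (pad4Anchor E₀) h_K w`), `hasHyperbolicSeedOn_four_one_of_coherentSheafSeedPad4`,
  and the RUNG-LEVEL COMPOSITION `weilSixfolds_of_mixedDoors_coherent`: route `EightfoldBlochSeeds`' deciding theorem with the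
  binder `BlochSeedDiscOne` REPLACED by `CoherentSheafSeedPad4 C` + the REFEREED fact (d = 1 through the coherent door, d = 3
  and generic d through Bloch) — trust base at d = 1: Compositio 137 (2003) Thm. 5.1, not the perfect-complex door's
  Pridham ∕ Perry assumption of `TorusCarrierSheafDoor.weilSixfolds_of_mixedDoors`. PROVED compositions; both seeds OPEN.
§19.3 THE COHERENT SEED CHECKER on (design json, presentation = (`𝓔`, resolution `R`)):
  `CleanAtSeedCoh C I F h 𝓔 R μ` ((A1@Z) IN THE WINDOW `I`, read as `chCoh`), `cleanAtSeedCoh_smul ∕ _symH_of_hStd`,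
  AGREEMENT with v4 on vector bundles `cleanAtSeedCoh_ofFiniteLocallyFree_iff` (trivial resolution, fact-free) and
  `cleanAtSeedCoh_iff_cleanAtSeed_of_coh` (ANY resolution, under Hartshorne III 6.9 (b)); the checker
  `Design.CoherentSheafSeedCheck D C I K 𝓔 R := C0′ ∧ 4 ∈ I ∧ IsBFSemiregularVia _ R I ∧ CleanAtSeedCoh C I K.F h_std 𝓔 R μ(D)`;
  SOUNDNESS `hasHyperbolicSeedOn_of_coherentSheafSeedCheck` and
  `hasLocallyAlgebraicWeilAnchor_four_one_of_BFcoherent_of_coherentSheafSeedCheck`; COMPARISON: v4's `Design.SheafSeedCheck`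
  and v5's window form both give a passing coherent check on the trivial resolution (`Design.SheafSeedCheck.coherent`,
  `coherentSheafSeedCheck_of_window`).
§19.4 PRESENTATION ARITHMETIC FOR NON-LOCALLY-FREE DISPLAYS (the «window form» asked by monad-4 g9, INBOX l.10254, and (Q1)):
  `IsSupportedInCodim 𝓠 c` (honest carrier: `𝓠` vanishes on an open whose complement has coheight `≥ c`); the LAW
  `ChSupportGap C X c` («`ch_p` of a coherent sheaf supported in codimension `≥ c` vanishes for `p < c`»; Fulton Ex. 15.2.16 (b) ∕
  15.3.6 in the topological model; NOT derivable from `ChernCharacterBetti`'s fields — a named `Prop`, hypothesis by name);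
  the LAX-MONAD (α′-SPLIT) LAW ON THE REAL CARRIER, PROVED on any complex abelian variety under Hartshorne III 6.9 (b):
  `chCoh_laxMonad` — for `𝓐 ↪ 𝓚 = ker q ↠ E`, `𝓚 ↪ 𝓑 ↠ im q`, `im q ↪ 𝓒 ↠ 𝓠 = coker q` short exact,
  `ch_k(E) = ch_k(𝓑) − ch_k(𝓐) − ch_k(𝓒) + ch_k(𝓠)`; WINDOW AGREEMENT `chCoh_laxMonad_window` (if `ch_p(𝓠) = 0` for `p ∈ I` the
  window sees the design side only) and `cleanAtSeedCoh_of_laxMonad` ((A1@Z) of `E` in the window from (A1@Z) of the virtual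
  datum `[𝓑] − [𝓐] − [𝓒]` + vanishing of `ch(𝓠)|_I`), `forall_chCoh_eq_zero_of_chSupportGap` (the vanishing from the law when
  `𝓠` is supported in codimension `> max I`; for monad-4's codimension-`5` cokernel and `I ⊆ {0,…,4}` the degenerate map is
  INVISIBLE to the window check — it moves only `ch₅…ch₈`, which the coherent door does not read).
§19.5 FLAGS (cumulative table in the memo `SEED-CHECKER-C5C8-c5c8-1-g18.md`):
  F19-1 `C.ch X 𝓔 p` for a NON-locally-free `𝓔` is unconstrained by `ChernCharacterBetti` (its fields speak of vector bundles
        only): v4 `CleanAtSeed ∕ RealisedBy ∕ SheafSeedCheck` are MEANINGFUL ONLY under `IsFiniteLocallyFree 𝓔` (which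
        `SheafSeedCheck` does carry) — for any other presentation use `CleanAtSeedCoh` (this file). Not an error in v4; a scope note.
  F19-2 (σ) ∕ (A1@Z) for the coherent door are WINDOW-ONLY: no condition on `ch_p`, `p ∉ I`; `I ⊆ {0,…,8}` is NOT needed.
  F19-3 (C7ᶜ) `IsBFSemiregularVia` is independent of the window `[a, 0]` and of the resolution up to quasi-isomorphism (tree, on
        this very carrier: `HomComplex.isISemiregularC_iff_of_window`, `HomComplex.isISemiregularC_iff_of_quasiIso'` in
        `Literature/…/HomComplexSigmaWindow.lean`) — recorded, not re-proved here.
  F19-4 (pad4) ∕ (d = 1) unchanged: in the types; the anchor kit is inhabited (v6.2 `anchorKit_nonempty`).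
  F19-5 C5ᶜ (the presentation is a coherent sheaf with a finite locally free resolution) replaces C5 (lci) and C6 (integral,
        codim 4) of the lci door — neither has a coherent analogue; `Ext^{<0} = 0` is automatic for a sheaf and is NOT a clause
        of the coherent door (it is one of the PERFECT-COMPLEX door `gluableSigmaAdmissible`, which also wants `{1,…,8} ⊆ I`).

## v20 (hsemireg-c5c8-1 g19, 2026-08-30) — ADDITIVE §20: THE TWO-TERM (COKERNEL) PRESENTATION AT THE COHERENT DOOR

What the cell's presenters actually hand in (c4-1 HUB5 ∕ M72 rooms, the D17@14 line, the monad lines after the α′-split) is a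
TWO-TERM datum: an injective map of vector bundles `φ : 𝓟 ↪ 𝓝` on `S⁴` whose letters realise the design's `P`- and `N`-tensors,
the presented sheaf being `𝓔 = coker φ` — in general NOT locally free (21-frontier LAW LF: a destabilising sub-line-bundle;
monad-4: `coker q ≠ 0` in codimension `5`). v4's `CokernelPresentation` cannot read such a datum (it asks `IsVectorBundle 𝓔`,
because v4's door is the vector-bundle door and `ChernCharacterBetti.ch_shortExact` needs vector-bundle ends), and v19's coherent
checker wants a resolution `R` as INPUT. §20 closes the gap, fact-free, by name:
* §20.1 `RealisesTensorCoh C Φ 𝓕 R T`, `Design.RealisedByCoh D C F h 𝓔 R` — the coherent forms of v4's dictionary predicates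
  (`chCoh` on a resolution in place of `C.ch`); agreement with v4 on the trivial resolution (`…_ofFiniteLocallyFree_iff`);
  `Design.realisedByCoh_of_realisesTensorCoh` ((A1) collapse, coherent); `cleanAtSeedCoh_of_realisedByCoh` ((A1@Z)ᶜ ⟸ realisation).
* §20.2 `CokernelPresentationCoh C Φ D 𝓔` — `0 → 𝓟 → 𝓝 → 𝓔' ≅ 𝓔 → 0` short exact with `𝓟`, `𝓝` FINITE LOCALLY FREE and NOTHING asked
  of `𝓔`; ITS RESOLUTION `π.resolution` (C5ᶜ FOR FREE: the cone resolution `[𝓟 → 𝓝]` in degrees `−1, 0`,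
  `StrictlyPerfectResolution.cone` of `KTheory/CoherentEulerCharacteristic.lean` on the trivial resolution of `𝓟`, transported along
  `𝓔' ≅ 𝓔`); `chCoh_resolution : ch_k(𝓔) = ch_k(𝓝) − ch_k(𝓟)` (`chCoh_cone`, NO Hartshorne fact, NO hypothesis on `S⁴` or `𝓔`);
  hence `realisesTensorCoh_resolution`, `realisedByCoh` and `cleanAtSeedCoh` — (A1@Z)ᶜ ON THE CONE RESOLUTION IS IMPLIED BY C0 (`Clean`)
  + THE TWO SIDE REALISATIONS (FLAG F20-1); `CokernelPresentation.toCoh` (every v4 presentation is one); on a vector bundle `𝓔` the cone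
  resolution computes `C.ch 𝓔` itself (`chCoh_resolution_eq_ch`, fact-free — compare v19's `cleanAtSeedCoh_iff_cleanAtSeed_of_coh`,
  which needs Hartshorne III 6.9 (b) for an ARBITRARY resolution).
* §20.3 (C7ᶜ FOR A TWO-TERM DATUM) `cone_isStrictlyGE` (the cone of `P• → E[0]` with `P• ≥ a`, `a ≤ 1`, lives in degrees `≥ a − 1`),
  `isStrictlyGE_resolution` (window `[−1, 0]`), `CokernelPresentationCoh.IsSemiregular π I` :=
  `HomComplex.IsISemiregularC S⁴ π.resolution.P (−1) 0 _ {q | q+1 ∈ I}` — BF `I`-semiregularity OF THE TWO-TERM COMPLEX `[𝓟 → 𝓝]`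
  ITSELF, i.e. joint injectivity of `(σ_q)_{q+1 ∈ I}` on `Hom_{D(S⁴)}([𝓟→𝓝], [𝓟→𝓝][2]) = Ext²(𝓔, 𝓔)`; `isBFSemiregularVia_resolution_iff`
  (it IS v19's C7ᶜ clause on `π.resolution`, by window independence `HomComplex.isISemiregularC_iff_of_window`); CONSISTENCY WITH THE
  VECTOR-BUNDLE DOOR `isSemiregular_iff_isISemiregular` (if `𝓔` happens to be finite locally free, C7ᶜ of the two-term complex is v4's
  module-level `IsISemiregular h𝓔 _`, along the augmentation quasi-isomorphism: `HomComplex.isISemiregularC_iff_of_quasiIso'` +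
  `HomComplex.isISemiregularC_single₀_iff`).
* §20.4 THE TWO-TERM SEED CHECKER `Design.TwoTermSeedCheck D C I W π := C0′ ∧ 4 ∈ I ⊆ {0,…,8} ∧ π.IsSemiregular I` — json clauses + ONE
  object clause; SOUNDNESS `Design.coherentSheafSeedCheck_of_twoTermSeedCheck` (it passes v19's coherent checker on `π.resolution`), the
  FLAG AS AN IFF `Design.twoTermSeedCheck_iff` (for `I ⊆ {0,…,8}` the two-term checker IS v19's coherent checker on the cone resolution:
  the (A1@Z)ᶜ clause carries no information beyond C0 — F20-1), the leaf `hasHyperbolicSeedOn_of_twoTermSeedCheck` ∕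
  `hasLocallyAlgebraicWeilAnchor_four_one_of_BFcoherent_of_twoTermSeedCheck` (REFEREED BF coherent, by name), and on a vector bundle
  `𝓔` the two-term checker IS v4's rank-free sheaf checker (`Design.twoTermSeedCheck_iff_sheafSeedCheckRankFree`, fact-free).
* §20.5 THE SPLIT SCREEN BY NAME (`HomComplexSigmaDinatural.lean` §3, PROVED tree lemmas): `splitScreen` — a strictly perfect model that
  is a direct sum `K₁• ⊞ K₂•` is `I`-semiregular ONLY IF `Ext²(K₁•, K₂•) = 0 = Ext²(K₂•, K₁•)` and both summands are `I`-semiregular;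
  `CokernelPresentationCoh.IsSemiregular.of_iso_biprod` (transport of C7ᶜ to a split model of `[𝓟 → 𝓝]`). This is the checker's verdict
  form of LAW RS (c4-1 HUB5: «every top-level N-cell of in-degree 0 splits off», `[𝓟 → 𝓝' ⊕ L] = [𝓟 → 𝓝'] ⊞ L[0]`): each split-off
  summand `L[0]` must have `Ext²(L, coker φ') = 0 = Ext²(coker φ', L)`-blocks killed and be semiregular itself — the room's
  «off-diagonal σ-kernel» digits ARE C7ᶜ failures at the refereed door. The sheaf-level twins (`SemiregularityMapDinatural.lean`) and
  the obstruction form (`Cruxes/BlochSeedDiscOne/SummandObstruction.lean`) are in the tree; nothing of them is restated.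
FLAGS v20: F20-1 (A1@Z)ᶜ ∕ (σ)ᶜ-class-half for a two-term datum are IMPLIED by C0 + the side realisations (PROVED, fact-free:
`Design.twoTermSeedCheck_iff`); F20-2 C5ᶜ is AUTOMATIC for a two-term datum (the cone resolution; LAW LF — «coker φ not locally free» —
does NOT bite at the coherent door: no clause reads local freeness of `𝓔`); F20-3 the ONLY object-side clause of the two-term checker is
C7ᶜ = `I`-semiregularity of the complex `[𝓟 → 𝓝]` (window `[−1,0]`), model- and window-independent (F19-3), equal to v4's C7 when `𝓔` is a
vector bundle; F20-4 LAW RS bites exactly through C7ᶜ, as the split screen (necessary conditions, by name); F20-5 (pad4) ∕ (d = 1) ∕ C8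
unchanged (in the types; vacuous as separate checks). No declaration of §19.1–§19.4 is changed; v20 adds imports
(`HomComplexSigmaWindow`, `HomComplexSigmaDinatural`, `Modules/VectorBundleFiniteLocallyFree`, `Motives/ChernClassesProofs`) and §20 only.


## References

* [BuchweitzFlenner2003] R.-O. Buchweitz, H. Flenner, *A semiregularity map for modules and applications to deformations*,
  Compositio Math. 137 (2003) 135–210 — Def. 4.1, §5 (I-semiregular: arXiv p. 25 L40–62) and Thm. 5.1 (arXiv p. 25 L65–80).
  [corpus: paper:arxiv-math_9912245 p.25]
* [Fulton1998] W. Fulton, *Intersection Theory*, 2nd ed. — Example 15.2.16 (b) («ch maps `F_k K∘X` into `F_k A_*(X)_ℚ`»),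
  Example 15.1.5, Example 15.3.6 («if `α ∈ F^pX` then `c_i(α) = 0` for `0 < i < p`»). [corpus: book:fultonnd-intersection-theory
  p0283 L19–43, p0287 L9]
* [Hartshorne1977] R. Hartshorne, *Algebraic Geometry*, III Ex. 6.9 (b) (tree fact `KTheory.Hartshorne1977_eulerChar_resolution_shortExact`).
-/

noncomputable section

set_option linter.dupNamespace false

open CategoryTheory CategoryTheory.Limits AlgebraicGeometry
open Literature.AlgebraicGeometry Literature.AlgebraicGeometry.Motives Literature.AlgebraicGeometry.HodgeTheory
open Literature.AlgebraicGeometry.Modules Literature.AlgebraicGeometry.KTheory Literature.AlgebraicGeometry.Morphisms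
open Literature.AlgebraicTopology.SingularHomology

namespace Summit.HodgeConjecture.HodgeConjecture.Cruxes.BlochSeedDiscOne.SeedChecker

open Summit.HodgeConjecture.HodgeConjecture.Cruxes.BlochSeedDiscOne.Anchor
open Summit.Ventures.HSemireg Summit.Ventures.HSemireg.Pad4Tower
open Summit.HodgeConjecture.HodgeConjecture.WeilTypeLadder

/-! ## §19.1 The coherent object class and its REFEREED door -/

section CoherentClass

/-- **(C7ᶜ) Buchweitz–Flenner `I`-semiregularity of an `𝒪_{X₀}`-module `ℰ₀`, READ ON a strictly perfect resolution `R`**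
(Chern-degree window `I`; form degrees `{q | q + 1 ∈ I}`): for some amplitude window `[a, 0]` containing `R.P`, the components
`(σ_q)_{q+1 ∈ I}` of the semiregularity map of the perfect complex `R.P ≃ ℰ₀` are jointly injective on
`Hom_{D(X₀)}(R.P, R.P[2]) = Ext²(ℰ₀, ℰ₀)` (`HomComplex.IsISemiregularC`, Mathlib's standard derived category). VERBATIM the
seed hypothesis of the refereed fact `BuchweitzFlenner2003_variationalHodge_ISemiregular_coherent`; independent of `a` and of `R`
(FLAG F19-3). A PREDICATE, nothing asserted. [cite: BuchweitzFlenner2003, Def. 4.1 and §5 (I-semiregular)] -/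
def IsBFSemiregularVia (X₀ : SchemeOver ℂ) {E₀ : X₀.left.Modules} (R : StrictlyPerfectResolution E₀) (I : Finset ℕ) :
    Prop :=
  ∃ (a : ℤ) (_ : R.P.IsStrictlyGE a),
    letI := HasDerivedCategory.standard X₀.left.Modules
    Literature.AlgebraicGeometry.HodgeTheory.HomComplex.IsISemiregularC X₀ R.P a 0 R.isBoundedVB.isFiniteLocallyFree
      {q | q + 1 ∈ I}

/-- **The COHERENT sheaf class** (instance of the venture's `ObjClass`): `(κ_p)_{p ∈ I}` are the Chern character components
`ch_p(ℰ₀) = chCoh C X₀ ℰ₀ R p` of an `𝒪_{X₀}`-module `ℰ₀` GIVEN WITH a strictly perfect resolution `R` on which it is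
`I`-semiregular (`IsBFSemiregularVia`). BF's «`I`-semiregular coherent sheaf `ℰ_0` with `α_p(0) = ch_p(ℰ_0)`, `p ∈ I`» — the
printed generality of Thm. 5.1. [cite: BuchweitzFlenner2003, §5 Thm. 5.1 (hypotheses) and §5 (I-semiregular)] -/
def cohSheafClass (C : ChernCharacterBetti) : ObjClass := fun _ X₀ I κ =>
  ∃ (E₀ : X₀.left.Modules) (R : StrictlyPerfectResolution E₀),
    IsBFSemiregularVia X₀ R I ∧ ∀ p ∈ I, κ p = chCoh C X₀ E₀ R p

/-- **BF Thm. 5.1 in COHERENT generality IS the local variational statement for the coherent class** — a binder shuffle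
(`κ_p = ch_p(ℰ₀) = chPerfect C X₀ R.P _ p` on `I`, `chCoh_eq_chPerfect` is `rfl`). Trust base: REFEREED (Compositio 137).
[cite: BuchweitzFlenner2003, §5 Thm. 5.1] -/
theorem localVariationalHodgeFor_cohSheafClass (hBF : BuchweitzFlenner2003_variationalHodge_ISemiregular_coherent)
    (C : ChernCharacterBetti) : LocalVariationalHodgeFor (cohSheafClass C) := by
  intro 𝒳 S π n hπ hS U hU s₀ X₀ e I κ hκ hHodge
  obtain ⟨E₀, R, hsr, hch⟩ := hκ
  have hHodge' : ∀ p ∈ I, ∀ (t : U) (γ : Path.Homotopic.Quotient s₀ t),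
      IsOfHodgeType n (fiberOver π t.1) (2 * p) p p
        (transportFun π (2 * p) hU γ
          (complexBetti.map e.inv (2 * p) (chPerfect C X₀ R.P R.isBoundedVB.isFiniteLocallyFree p))) := by
    intro p hp t γ
    rw [← chCoh_eq_chPerfect, ← hch p hp]
    exact hHodge p hp t γ
  obtain ⟨W, hWo, hW₀, hWU, hW⟩ := hBF C π n hπ hS hU s₀ X₀ e E₀ R I hsr hHodge'
  refine ⟨W, hWo, hW₀, hWU, fun p hp t γ => ?_⟩
  rw [hch p hp, chCoh_eq_chPerfect]
  exact hW p hp t γ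

/-- **Caveat C1 lifted: every Buchweitz–Flenner VECTOR-BUNDLE seed is a coherent seed** — take the trivial resolution
`ℰ₀[0]` (window `[0, 0]`): complex-level `I`-semiregularity of `ℰ₀[0]` is the module-level one
(`HomComplex.isISemiregularC_single₀_iff`) and `chCoh` on the trivial resolution is `C.ch` (`chCoh_ofFiniteLocallyFree`).
[cite: BuchweitzFlenner2003, §5 (I-semiregular) and §4 (arXiv p. 20 L5–8: a module in degree 0 is perfect)] -/
theorem cohSheafClass_of_bfSheafClass (C : ChernCharacterBetti) {n : ℕ} {X₀ : SchemeOver ℂ} {I : Finset ℕ}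
    {κ : (p : ℕ) → complexBetti X₀ (2 * p)} (h : bfSheafClass C n X₀ I κ) : cohSheafClass C n X₀ I κ := by
  obtain ⟨E₀, hE₀, hsr, hch⟩ := h
  letI := HasDerivedCategory.standard X₀.left.Modules
  let R : StrictlyPerfectResolution E₀ := StrictlyPerfectResolution.ofFiniteLocallyFree hE₀
  have hK : ∀ p, IsFiniteLocallyFree
      ((Literature.AlgebraicGeometry.HodgeTheory.HomComplex.single₀ X₀.left E₀).X p) :=
    R.isBoundedVB.isFiniteLocallyFree
  refine ⟨E₀, R, ⟨0,
    inferInstanceAs ((Literature.AlgebraicGeometry.HodgeTheory.HomComplex.single₀ X₀.left E₀).IsStrictlyGE 0),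
    (Literature.AlgebraicGeometry.HodgeTheory.HomComplex.isISemiregularC_single₀_iff X₀ E₀ hE₀ hK
      {q | q + 1 ∈ I}).2 hsr⟩, fun p hp => ?_⟩
  rw [hch p hp]
  exact (chCoh_ofFiniteLocallyFree C X₀ E₀ hE₀ p).symm

/-- Hence the REFEREED coherent fact also serves the vector-bundle sheaf door (`LocalVariationalHodgeFor.anti` along
`bfSheafClass ≤ cohSheafClass`). [cite: BuchweitzFlenner2003, §5 Thm. 5.1] -/
theorem localVariationalHodgeFor_bfSheafClass_of_coherent
    (hBF : BuchweitzFlenner2003_variationalHodge_ISemiregular_coherent) (C : ChernCharacterBetti) :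
    LocalVariationalHodgeFor (bfSheafClass C) :=
  (localVariationalHodgeFor_cohSheafClass hBF C).anti fun _ _ _ _ h => cohSheafClass_of_bfSheafClass C h

/-- A seed of the vector-bundle class is a seed of the coherent class. [cite: BuchweitzFlenner2003, §5 (I-semiregular)] -/
theorem HasSeedOn.coherent_of_bf {C : ChernCharacterBetti} {n : ℕ} {P : AbelianVariety ℂ} {h : complexBetti P.X 2}
    {w : complexBetti P.X (2 * n)} (hS : HasSeedOn (bfSheafClass C) n P h w) : HasSeedOn (cohSheafClass C) n P h w :=
  hS.mono fun _ _ _ _ hκ => cohSheafClass_of_bfSheafClass C hκ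

/-- **THE COHERENT DOOR AT ANCHOR LEVEL**: BF Thm. 5.1 (coherent, REFEREED) ∧ ONE hyperbolic seed of the coherent class at
level `N` for `ℚ(√-d)` ⟹ `HasLocallyAlgebraicWeilAnchor N d` (the venture's door-agnostic
`hasLocallyAlgebraicWeilAnchor_of_localVariationalHodgeFor_of_hyperbolicSeedOn`). HC ∕ HC_AV NOT proved: the seed is OPEN.
[cite: BuchweitzFlenner2003, §5 Thm. 5.1] [cite: vanGeemen1994HodgeAV, 5.2–5.4] -/
theorem hasLocallyAlgebraicWeilAnchor_of_BFcoherent_of_hyperbolicSeedOn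
    (hBF : BuchweitzFlenner2003_variationalHodge_ISemiregular_coherent) {C : ChernCharacterBetti} {N d : ℕ}
    (hS : HasHyperbolicSeedOn (cohSheafClass C) N d) : HasLocallyAlgebraicWeilAnchor N d :=
  hasLocallyAlgebraicWeilAnchor_of_localVariationalHodgeFor_of_hyperbolicSeedOn
    (localVariationalHodgeFor_cohSheafClass hBF C) hS

end CoherentClass

/-! ## §19.2 The pad-4 member form and the rung-level composition (d = 1 through the coherent door) -/

section PadFour

variable (C : ChernCharacterBetti)

/-- **`CoherentSheafSeedPad4 C` — the pad-4 MEMBER FORM of a coherent seed** (PREDICATE, OPEN, nothing asserted): on the named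
pad-4 anchor `S⁴(E₀)` of every CM curve `(E₀, ψ₀)`, `ψ₀² = −1`, there are a projective embedding `e`, a rational hyperplane class
`a ≠ 0` with `(pad4Anchor, pad4Action)` HYPERBOLIC for `h_K(e, a)`, a non-zero rational class `w` of the `ℚ(i)`-Weil plane, and a
seed of the COHERENT class for `q·h_K⁴ + w` (`HasSeedOn (cohSheafClass C)`: `4 ∈ I`, an `𝒪`-module with a strictly perfect
resolution, `I`-semiregular on it, `ch_4 = q·h_K⁴ + w`, `ch_p = c_p h_Kᵖ` for `p ∈ I ∖ {4}`). Verbatim STUB R of `Lines/birth.lean`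
(`TorusCarrierSheafSeedPad4`) with the seed clause replaced. No implication with `BlochSeedDiscOne` is claimed in either
direction (different anchors; Bloch's semiregularity of an lci `Z` vs BF's of the module `𝒪_Z`).
[cite: BuchweitzFlenner2003, §5 Thm. 5.1 (hypotheses)] [cite: Bloch1972Semiregularity, Remark (7.5)] -/
def CoherentSheafSeedPad4 : Prop :=
  ∀ (E₀ : AbelianVariety ℂ) (ψ₀ : E₀ ⟶ E₀), E₀.dim = 1 → ψ₀ ≫ ψ₀ = -(1 • 𝟙 E₀) →
    ∃ (e : ProjectiveEmbedding (pad4Anchor E₀).X) (a : complexBetti (projectiveSpace e.n ℂ) 2)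
      (w : complexBetti (pad4Anchor E₀).X (2 * 4)),
      IsRationalClass a ∧ a ≠ 0 ∧
      IsHyperbolicWeilType (pad4Anchor E₀) (pad4Action E₀ ψ₀) 4 (symH (pad4Action E₀ ψ₀) e a) ∧
      w ∈ weilClassesOf (pad4Anchor E₀) (pad4Action E₀ ψ₀) 4 1 ∧ IsRationalClass w ∧ w ≠ 0 ∧
      HasSeedOn (cohSheafClass C) 4 (pad4Anchor E₀) (symH (pad4Action E₀ ψ₀) e a) w

variable {C}

/-- The member form gives the existential hyperbolic coherent seed at level 4 for `K = ℚ(i)` (anchor bookkeeping: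
`exists_cmCurve_sqrt_neg 1`, `pad4Anchor_dim`, `pad4Action_comp_self`). [cite: vanGeemen1994HodgeAV, 5.2–5.4] -/
theorem hasHyperbolicSeedOn_four_one_of_coherentSheafSeedPad4 (hS : CoherentSheafSeedPad4 C) :
    HasHyperbolicSeedOn (cohSheafClass C) 4 1 := by
  obtain ⟨E₀, ψ₀, hE, hψ⟩ :=
    Literature.NumberTheory.EllipticCurves.CMEndomorphism.exists_cmCurve_sqrt_neg 1 one_pos
  obtain ⟨e, a, w, ha, ha0, hhyp, hwW, hwr, hw0, hseed⟩ := hS E₀ ψ₀ hE hψ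
  exact ⟨pad4Anchor E₀, pad4Action E₀ ψ₀, e, a, w, pad4Anchor_dim hE, pad4Action_comp_self hψ, ha, ha0, hhyp,
    hwW, hwr, hw0, hseed⟩

/-- Member form + REFEREED coherent BF ⟹ `HasLocallyAlgebraicWeilAnchor 4 1` (the d = 1 local input of the rung; the SAME leaf
the lci door of 18881 feeds through Bloch (7.4)). [cite: BuchweitzFlenner2003, §5 Thm. 5.1] -/
theorem hasLocallyAlgebraicWeilAnchor_four_one_of_BFcoherent_of_coherentSheafSeedPad4
    (hBF : BuchweitzFlenner2003_variationalHodge_ISemiregular_coherent) (hS : CoherentSheafSeedPad4 C) :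
    HasLocallyAlgebraicWeilAnchor 4 1 :=
  hasLocallyAlgebraicWeilAnchor_of_BFcoherent_of_hyperbolicSeedOn hBF
    (hasHyperbolicSeedOn_four_one_of_coherentSheafSeedPad4 hS)

/-- **RUNG-LEVEL COMPOSITION (PROVED; both seeds OPEN)**: route `EightfoldBlochSeeds`' deciding theorem with the binder
`BlochSeedDiscOne` (18881) REPLACED by the coherent member form + the REFEREED coherent BF fact — mixed doors per `d` through
`weilSixfolds_of_reach_of_localAnchor_four`: `d = 1` by the coherent door, `d = 3` and generic `d` by Bloch seeds + Bloch (7.4).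
Compare `TorusSheafDoor.weilSixfolds_of_mixedDoors` (d = 1 through the PERFECT-COMPLEX door, whose transfer is an assumption of
printed strength): here the d = 1 transfer is Compositio 137 (2003) Thm. 5.1. Conclusion = the rung-H2 leaf. NOT a proof of 18881.
[cite: BuchweitzFlenner2003, §5 Thm. 5.1] [cite: Markman2025SecantWeil, §1.2 (preprint)] [cite: Schoen1998HodgeWeilAddendum, §10] -/
theorem weilSixfolds_of_mixedDoors_coherent (h₂ : Theses.EightfoldBlochSeeds.BlochSeedsGeneric)
    (hS : CoherentSheafSeedPad4 C) (h₄ : Theses.EightfoldBlochSeeds.BlochSeedDiscThree)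
    (hF : Theses.EightfoldBlochSeeds.ReachHyperbolic) (hB : Theses.EightfoldBlochSeeds.BlochSpreadEightFour)
    (hBF : BuchweitzFlenner2003_variationalHodge_ISemiregular_coherent) :
    Theses.SevenfoldWeilCensus.WeilSixfolds :=
  weilSixfolds_of_reach_of_localAnchor_four hF fun d hd => by
    by_cases h1 : d = 1
    · subst h1
      exact hasLocallyAlgebraicWeilAnchor_four_one_of_BFcoherent_of_coherentSheafSeedPad4 hBF hS
    by_cases h3 : d = 3
    · subst h3
      exact hasLocallyAlgebraicWeilAnchor_of_blochSpread_of_hyperbolicBlochSeed hB h₄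
    · exact hasLocallyAlgebraicWeilAnchor_of_blochSpread_of_hyperbolicBlochSeed hB (h₂ d hd h1 h3)

/-- `∀ C` registration shape (idea-crit-6 price T1): the Chern-character theory is shared with the door. -/
def CoherentSheafSeedPad4All : Prop := ∀ C : ChernCharacterBetti, CoherentSheafSeedPad4 C

theorem weilSixfolds_of_mixedDoors_coherent_all (h₂ : Theses.EightfoldBlochSeeds.BlochSeedsGeneric)
    (hS : CoherentSheafSeedPad4All) (h₄ : Theses.EightfoldBlochSeeds.BlochSeedDiscThree)
    (hF : Theses.EightfoldBlochSeeds.ReachHyperbolic) (hB : Theses.EightfoldBlochSeeds.BlochSpreadEightFour)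
    (hBF : BuchweitzFlenner2003_variationalHodge_ISemiregular_coherent) (C : ChernCharacterBetti) :
    Theses.SevenfoldWeilCensus.WeilSixfolds :=
  weilSixfolds_of_mixedDoors_coherent h₂ (hS C) h₄ hF hB hBF

end PadFour

/-! ## §19.3 The coherent seed checker on (design json, presentation = (`𝓔`, `R`)) -/

section Checker

variable {E₀ : AbelianVariety ℂ} {ψ₀ : E₀ ⟶ E₀}

/-- **(A1@Z)ᶜ — (A1)-CLEANLINESS AT THE SEED IN THE WINDOW `I`, COHERENT FORM**: for an `𝒪_{S⁴}`-module `𝓔` GIVEN WITH a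
strictly perfect resolution `R`, relative to a Chern character theory `C`, a polarisation class `h` and the Weil frame `F`:
`ch_p(𝓔) = c_p·hᵖ` for `p ∈ I ∖ {4}` and `ch₄(𝓔) = q·h⁴ + wOf μ`, where `ch_p(𝓔) := chCoh C S⁴ 𝓔 R p` (the Chern character of
the class `[𝓔] = Σ(−1)ⁱ[R.Pⁱ] ∈ K₀`). WINDOW-ONLY (FLAG F19-2): nothing is asked of `ch_p`, `p ∉ I`. On a vector bundle with its
trivial resolution this IS v4's `CleanAtSeed` (`cleanAtSeedCoh_ofFiniteLocallyFree_iff`). [cite: BuchweitzFlenner2003, §5 Thm. 5.1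
(hypothesis «α_p(0) = ch_p(ℰ_0), p ∈ I»)] [cite: Fulton1998, §15.1] -/
def CleanAtSeedCoh (C : ChernCharacterBetti) (I : Finset ℕ) (F : WeilFrame E₀ ψ₀) (h : complexBetti (pad4Anchor E₀).X 2)
    (𝓔 : (pad4Anchor E₀).X.left.Modules) (R : StrictlyPerfectResolution 𝓔) (μ : GaussianInt) : Prop :=
  ∃ (c : ℕ → ℚ) (q : ℚ), (∀ p ∈ I, p ≠ 4 → chCoh C (pad4Anchor E₀).X 𝓔 R p = ((c p : ℚ) : ℂ) • cupPowTwo h p) ∧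
    chCoh C (pad4Anchor E₀).X 𝓔 R 4 = ((q : ℚ) : ℂ) • cupPowTwo h 4 + F.wOf μ

/-- `(c • x)ⁱ = cⁱ • xⁱ` (bilinearity of `∪`; private copy of the tree's `cupPowTwo_smul`, as in v4 ∕ v5 ∕ v9 ∕ v11, to stay
independent of which of its homes is imported). [cite: HatcherAT2002, §3.2] -/
private theorem cupPowTwo_smul_aux₁₉ {Y : Type} [TopologicalSpace Y] (c : ℂ) (x : singularCohomology ℂ ℂ Y 2)
    (i : ℕ) : cupPowTwo (c • x) i = c ^ i • cupPowTwo x i := by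
  induction i with
  | zero => rw [cupPowTwo_zero, cupPowTwo_zero, pow_zero, one_smul]
  | succ i ih =>
    rw [cupPowTwo_succ, cupPowTwo_succ, ih]
    simp only [map_smul, LinearMap.smul_apply, smul_smul, pow_succ, mul_comm]

/-- (A1@Z)ᶜ is insensitive to rescaling the polarisation class by a non-zero rational (checked against `h_std`, consumed
against `h_K = 2t·h_std`). -/
theorem cleanAtSeedCoh_smul {C : ChernCharacterBetti} {I : Finset ℕ} {F : WeilFrame E₀ ψ₀}
    {h : complexBetti (pad4Anchor E₀).X 2} {𝓔 : (pad4Anchor E₀).X.left.Modules} {R : StrictlyPerfectResolution 𝓔}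
    {μ : GaussianInt} (hcl : CleanAtSeedCoh C I F h 𝓔 R μ) {r : ℚ} (hr : r ≠ 0) :
    CleanAtSeedCoh C I F (((r : ℚ) : ℂ) • h) 𝓔 R μ := by
  obtain ⟨c, q, hc, hq⟩ := hcl
  have hr' : ∀ p : ℕ, ((r : ℚ) : ℂ) ^ p ≠ 0 := fun p => pow_ne_zero _ (by exact_mod_cast hr)
  have key : ∀ (p : ℕ) (x : ℚ), ((x : ℚ) : ℂ) • cupPowTwo h p =
      (((x / r ^ p : ℚ)) : ℂ) • cupPowTwo (((r : ℚ) : ℂ) • h) p := by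
    intro p x
    rw [cupPowTwo_smul_aux₁₉, smul_smul, Rat.cast_div, Rat.cast_pow, div_mul_cancel₀ _ (hr' p)]
  refine ⟨fun p => c p / r ^ p, q / r ^ 4, fun p hpI hp => ?_, ?_⟩
  · rw [hc p hpI hp, key p (c p)]
  · rw [hq, key 4 q]

theorem cleanAtSeedCoh_symH_of_hStd (hE : E₀.dim = 1) (hψ : ψ₀ ≫ ψ₀ = -(1 • 𝟙 E₀)) {C : ChernCharacterBetti}
    {I : Finset ℕ} (K : AnchorKit E₀ ψ₀) {𝓔 : (pad4Anchor E₀).X.left.Modules} {R : StrictlyPerfectResolution 𝓔}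
    {μ : GaussianInt} (hcl : CleanAtSeedCoh C I K.F (hStd E₀ K.η) 𝓔 R μ) :
    CleanAtSeedCoh C I K.F (symH (pad4Action E₀ ψ₀) K.pol.e K.pol.a) 𝓔 R μ := by
  rw [K.symH_eq hE hψ]
  exact cleanAtSeedCoh_smul hcl (mul_ne_zero two_ne_zero K.pol.t_pos.ne')

/-- **AGREEMENT WITH v4 ON VECTOR BUNDLES (trivial resolution, fact-free)**: `CleanAtSeedCoh` on `𝓔[0]` is v4's `CleanAtSeed`.
[cite: Fulton1998, §15.1 and Example 3.2.3] -/
theorem cleanAtSeedCoh_ofFiniteLocallyFree_iff {C : ChernCharacterBetti} {I : Finset ℕ} {F : WeilFrame E₀ ψ₀}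
    {h : complexBetti (pad4Anchor E₀).X 2} {𝓔 : (pad4Anchor E₀).X.left.Modules} (h𝓔 : IsFiniteLocallyFree 𝓔)
    {μ : GaussianInt} :
    CleanAtSeedCoh C I F h 𝓔 (StrictlyPerfectResolution.ofFiniteLocallyFree h𝓔) μ ↔ CleanAtSeed C I F h 𝓔 μ := by
  simp only [CleanAtSeedCoh, CleanAtSeed, chCoh_ofFiniteLocallyFree]

/-- **AGREEMENT WITH v4 ON VECTOR BUNDLES, ANY RESOLUTION** (under Hartshorne III Ex. 6.9 (b): resolution independence of
`chCoh` on the abelian variety `S⁴`; `𝓔` coherent). [cite: Hartshorne1977, III Ex. 6.9 (b) (p. 239)] -/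
theorem cleanAtSeedCoh_iff_cleanAtSeed_of_coh (hH : Hartshorne1977_eulerChar_resolution_shortExact.{0})
    {C : ChernCharacterBetti} {I : Finset ℕ} {F : WeilFrame E₀ ψ₀} {h : complexBetti (pad4Anchor E₀).X 2}
    {𝓔 : (pad4Anchor E₀).X.left.Modules} (h𝓔 : IsFiniteLocallyFree 𝓔) (hcoh : Coh 𝓔) (R : StrictlyPerfectResolution 𝓔)
    {μ : GaussianInt} : CleanAtSeedCoh C I F h 𝓔 R μ ↔ CleanAtSeed C I F h 𝓔 μ := by
  have key : ∀ p, chCoh C (pad4Anchor E₀).X 𝓔 R p = C.ch (pad4Anchor E₀).X 𝓔 p := fun p => by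
    rw [(pad4Anchor E₀).chCoh_eq C hH hcoh R (StrictlyPerfectResolution.ofFiniteLocallyFree h𝓔) p,
      chCoh_ofFiniteLocallyFree]
  simp only [CleanAtSeedCoh, CleanAtSeed, key]

/-- **(A1@Z)ᶜ + (C7ᶜ) ⟹ a seed of the coherent class** for `q·h⁴ + wOf μ` on `S⁴` (`4 ∈ I`). Pure repackaging.
[cite: BuchweitzFlenner2003, §5 Thm. 5.1 (hypotheses)] -/
theorem hasSeedOn_cohSheafClass_of_cleanAtSeedCoh {C : ChernCharacterBetti} {I : Finset ℕ} {F : WeilFrame E₀ ψ₀}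
    {h : complexBetti (pad4Anchor E₀).X 2} {𝓔 : (pad4Anchor E₀).X.left.Modules} {R : StrictlyPerfectResolution 𝓔}
    {μ : GaussianInt} (h4 : 4 ∈ I) (hsr : IsBFSemiregularVia (pad4Anchor E₀).X R I) (hcl : CleanAtSeedCoh C I F h 𝓔 R μ) :
    HasSeedOn (cohSheafClass C) 4 (pad4Anchor E₀) h (F.wOf μ) := by
  obtain ⟨c, q, hc, hq⟩ := hcl
  exact ⟨I, fun p => chCoh C (pad4Anchor E₀).X 𝓔 R p, q, c, h4, ⟨𝓔, R, hsr, fun _ _ => rfl⟩, hq, hc⟩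

/-- **THE COHERENT SEED CHECKER — a predicate on (design json, presentation = an `𝒪_{S⁴}`-module `𝓔` with a strictly perfect
resolution `R`)**: C0′ for `D` (rank-free class data: (A1)-clean and `μ ≠ 0` — the (σ) design half); `4 ∈ I`; (C7ᶜ)
`IsBFSemiregularVia S⁴ R I`; (A1@Z)ᶜ `CleanAtSeedCoh` with the design's `W`-coordinate `μ(D)` against `h_std`. C5ᶜ («the
presentation is a coherent sheaf with a finite locally free resolution») is the TYPE of the argument `R`; (pad4) ∕ (d = 1) are in the
types (FLAGS F19-4 ∕ F19-5). -/
def Design.CoherentSheafSeedCheck (D : Design) (C : ChernCharacterBetti) (I : Finset ℕ) (K : AnchorKit E₀ ψ₀)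
    (𝓔 : (pad4Anchor E₀).X.left.Modules) (R : StrictlyPerfectResolution 𝓔) : Prop :=
  D.ClassDataRankFree ∧ 4 ∈ I ∧ IsBFSemiregularVia (pad4Anchor E₀).X R I ∧ CleanAtSeedCoh C I K.F (hStd E₀ K.η) 𝓔 R D.mu

/-- **SOUNDNESS: a passing (design, coherent presentation) pair gives a hyperbolic seed of the coherent class at level 4 for
`ℚ(i)`.** Pure repackaging through the anchor kit. [cite: BuchweitzFlenner2003, §5 Thm. 5.1 (hypotheses)]
[cite: vanGeemen1994HodgeAV, 5.2–5.4] -/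
theorem hasHyperbolicSeedOn_of_coherentSheafSeedCheck (hE : E₀.dim = 1) (hψ : ψ₀ ≫ ψ₀ = -(1 • 𝟙 E₀)) {D : Design}
    {C : ChernCharacterBetti} {I : Finset ℕ} {K : AnchorKit E₀ ψ₀} {𝓔 : (pad4Anchor E₀).X.left.Modules}
    {R : StrictlyPerfectResolution 𝓔} (h : D.CoherentSheafSeedCheck C I K 𝓔 R) :
    HasHyperbolicSeedOn (cohSheafClass C) 4 1 := by
  obtain ⟨hC0, h4, hsr, hcl⟩ := h
  exact ⟨pad4Anchor E₀, pad4Action E₀ ψ₀, K.pol.e, K.pol.a, K.F.wOf D.mu, pad4Anchor_dim hE,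
    pad4Action_comp_self hψ, K.pol.a_rational, K.pol.a_ne_zero, K.hyperbolic_symH hE hψ, K.F.wOf_mem _,
    K.F.wOf_rational _, K.F.wOf_ne_zero hC0.2,
    hasSeedOn_cohSheafClass_of_cleanAtSeedCoh h4 hsr (cleanAtSeedCoh_symH_of_hStd hE hψ K hcl)⟩

/-- **A passing coherent check + REFEREED coherent BF ⟹ `HasLocallyAlgebraicWeilAnchor 4 1`.** HC ∕ HC_AV ∕ 18881 NOT proved: no
pair is shown to pass. [cite: BuchweitzFlenner2003, §5 Thm. 5.1] -/
theorem hasLocallyAlgebraicWeilAnchor_four_one_of_BFcoherent_of_coherentSheafSeedCheck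
    (hBF : BuchweitzFlenner2003_variationalHodge_ISemiregular_coherent) (hE : E₀.dim = 1)
    (hψ : ψ₀ ≫ ψ₀ = -(1 • 𝟙 E₀)) {D : Design} {C : ChernCharacterBetti} {I : Finset ℕ} {K : AnchorKit E₀ ψ₀}
    {𝓔 : (pad4Anchor E₀).X.left.Modules} {R : StrictlyPerfectResolution 𝓔} (h : D.CoherentSheafSeedCheck C I K 𝓔 R) :
    HasLocallyAlgebraicWeilAnchor 4 1 :=
  hasLocallyAlgebraicWeilAnchor_of_BFcoherent_of_hyperbolicSeedOn hBF (hasHyperbolicSeedOn_of_coherentSheafSeedCheck hE hψ h)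

/-- **COMPARISON: v4's sheaf-door checker passes the coherent checker on the trivial resolution** (`RealisedBy` in all degrees
`≤ 8` ⟹ (A1@Z) in the window; module-level ⟹ complex-level semiregularity on `𝓔[0]`). -/
theorem Design.SheafSeedCheck.coherent {D : Design} {C : ChernCharacterBetti} {I : Finset ℕ} {K : AnchorKit E₀ ψ₀}
    {𝓔 : (pad4Anchor E₀).X.left.Modules} (h : D.SheafSeedCheck C I K 𝓔) (h𝓔 : IsFiniteLocallyFree 𝓔) :
    D.CoherentSheafSeedCheck C I K 𝓔 (StrictlyPerfectResolution.ofFiniteLocallyFree h𝓔) := by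
  obtain ⟨hC0, h4, hI8, ⟨h𝓔', hsr⟩, hR⟩ := h
  letI := HasDerivedCategory.standard (pad4Anchor E₀).X.left.Modules
  have hK : ∀ p, IsFiniteLocallyFree
      ((Literature.AlgebraicGeometry.HodgeTheory.HomComplex.single₀ (pad4Anchor E₀).X.left 𝓔).X p) :=
    (StrictlyPerfectResolution.ofFiniteLocallyFree h𝓔).isBoundedVB.isFiniteLocallyFree
  refine ⟨hC0.rankFree, h4, ⟨0,
    inferInstanceAs
      ((Literature.AlgebraicGeometry.HodgeTheory.HomComplex.single₀ (pad4Anchor E₀).X.left 𝓔).IsStrictlyGE 0),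
    (Literature.AlgebraicGeometry.HodgeTheory.HomComplex.isISemiregularC_single₀_iff (pad4Anchor E₀).X 𝓔 h𝓔 hK
      {q | q + 1 ∈ I}).2 hsr⟩, ?_⟩
  exact (cleanAtSeedCoh_ofFiniteLocallyFree_iff h𝓔).2 (cleanAtSeed_of_realisedBy hI8 hR)

/-- **COMPARISON: v5's WINDOW-FORM vector-bundle data pass the coherent checker on the trivial resolution.** -/
theorem coherentSheafSeedCheck_of_window {D : Design} {C : ChernCharacterBetti} {I : Finset ℕ} {K : AnchorKit E₀ ψ₀}
    {𝓔 : (pad4Anchor E₀).X.left.Modules} (hC0 : D.ClassDataRankFree) (h4 : 4 ∈ I) (h𝓔 : IsFiniteLocallyFree 𝓔)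
    (hsr : IsISemiregular h𝓔 {q' | q' + 1 ∈ I}) (hcl : CleanAtSeed C I K.F (hStd E₀ K.η) 𝓔 D.mu) :
    D.CoherentSheafSeedCheck C I K 𝓔 (StrictlyPerfectResolution.ofFiniteLocallyFree h𝓔) := by
  letI := HasDerivedCategory.standard (pad4Anchor E₀).X.left.Modules
  have hK : ∀ p, IsFiniteLocallyFree
      ((Literature.AlgebraicGeometry.HodgeTheory.HomComplex.single₀ (pad4Anchor E₀).X.left 𝓔).X p) :=
    (StrictlyPerfectResolution.ofFiniteLocallyFree h𝓔).isBoundedVB.isFiniteLocallyFree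
  exact ⟨hC0, h4, ⟨0,
    inferInstanceAs
      ((Literature.AlgebraicGeometry.HodgeTheory.HomComplex.single₀ (pad4Anchor E₀).X.left 𝓔).IsStrictlyGE 0),
    (Literature.AlgebraicGeometry.HodgeTheory.HomComplex.isISemiregularC_single₀_iff (pad4Anchor E₀).X 𝓔 h𝓔 hK
      {q | q + 1 ∈ I}).2 hsr⟩, (cleanAtSeedCoh_ofFiniteLocallyFree_iff h𝓔).2 hcl⟩

end Checker

/-! ## §19.4 Presentation arithmetic for non-locally-free displays: support gap (LAW) and the lax-monad law (PROVED) -/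

section Presentation

/-- **«`𝓠` is supported in codimension `≥ c`»** (honest carrier, no stalks): there is an open `U` of the scheme `Y` on which `𝓠`
vanishes (every section module over an open inside `U` is zero) and off which every point has coheight `≥ c` (Mathlib's
specialisation preorder on `Y`). [cite: Hartshorne1977, II Ex. 1.14 and II §5 (support of a sheaf)] -/
def IsSupportedInCodim {Y : Scheme.{0}} (𝓠 : Y.Modules) (c : ℕ) : Prop :=
  ∃ U : Y.Opens, (∀ y : Y, y ∉ U → (c : ℕ∞) ≤ Order.coheight y) ∧
    ∀ V : Y.Opens, V ≤ U → IsZero (𝓠.val.obj (Opposite.op V))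

/-- The zero module is supported in every codimension (take `U = ⊤`). -/
theorem isSupportedInCodim_of_isZero {Y : Scheme.{0}} {𝓠 : Y.Modules} (h𝓠 : IsZero 𝓠) (c : ℕ) :
    IsSupportedInCodim 𝓠 c := by
  refine ⟨⊤, fun y hy => (hy trivial).elim, fun V _ => ?_⟩
  exact Functor.map_isZero (SheafOfModules.forget _ ⋙ PresheafOfModules.evaluation _ (Opposite.op V)) h𝓠

/-- **THE SUPPORT-GAP LAW** (a named `Prop`, HYPOTHESIS BY NAME, never asserted): on `X`, for every COHERENT `𝒪_X`-module `𝓠`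
with a strictly perfect resolution `R` and supported in codimension `≥ c`, `ch_p(𝓠) = chCoh C X 𝓠 R p = 0` for all `p < c`.
In print for `X` a non-singular variety: the class of `𝓠` lies in `F^c K∘X` (Example 15.1.5) and «ch maps `F_k K∘X` into
`F_k A_*(X)_ℚ`» (Example 15.2.16 (b)), equivalently «if `α ∈ F^pX` then `c_i(α) = 0` for `0 < i < p`» (Example 15.3.6), read
in Betti cohomology through the cycle class. NOT derivable from the fields of `ChernCharacterBetti` (which carry no support
axiom); intended consumer: `X = S⁴` smooth projective. [cite: Fulton1998, Example 15.2.16 (b), Example 15.1.5, Example 15.3.6] -/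
def ChSupportGap (C : ChernCharacterBetti) (X : SchemeOver ℂ) (c : ℕ) : Prop :=
  ∀ (𝓠 : X.left.Modules) (R : StrictlyPerfectResolution 𝓠), Coh 𝓠 → IsSupportedInCodim 𝓠 c →
    ∀ p : ℕ, p < c → chCoh C X 𝓠 R p = 0

/-- Under the law, a coherent `𝓠` supported in codimension `> max I` has `ch|_I = 0` — e.g. a codimension-`5` cokernel and a
window `I ⊆ {0, …, 4}`. [cite: Fulton1998, Example 15.2.16 (b)] -/
theorem forall_chCoh_eq_zero_of_chSupportGap {C : ChernCharacterBetti} {X : SchemeOver ℂ} {c : ℕ}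
    (hgap : ChSupportGap C X c) {𝓠 : X.left.Modules} (R : StrictlyPerfectResolution 𝓠) (hcoh : Coh 𝓠)
    (hsupp : IsSupportedInCodim 𝓠 c) {I : Finset ℕ} (hI : ∀ p ∈ I, p < c) : ∀ p ∈ I, chCoh C X 𝓠 R p = 0 :=
  fun p hp => hgap 𝓠 R hcoh hsupp p (hI p hp)

variable (C : ChernCharacterBetti) (A : AbelianVariety ℂ)

/-- **THE LAX-MONAD (α′-SPLIT) LAW ON THE REAL CARRIER, PROVED** on a complex abelian variety under Hartshorne III Ex. 6.9 (b):
for a monad `𝓐 →ⁱ 𝓑 →^q 𝓒` with `i` injective and `q ∘ i = 0` but `q` NOT assumed surjective, presented by its three short exact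
sequences `0 → 𝓐 → 𝓚 → E → 0` (`𝓚 = ker q`, `E = 𝓚 ∕ 𝓐` the display sheaf), `0 → 𝓚 → 𝓑 → 𝓙 → 0` (`𝓙 = im q`),
`0 → 𝓙 → 𝓒 → 𝓠 → 0` (`𝓠 = coker q`), all seven sheaves coherent with given resolutions:
`ch_k(E) = ch_k(𝓑) − ch_k(𝓐) − ch_k(𝓒) + ch_k(𝓠)`. (The design side is `ch(𝓑) − ch(𝓐) − ch(𝓒)`; the correction is `+ ch(coker q)`;
monad-4 g9's Mathlib-only `B3AlphaSplit.lean` is the abstract-additive shadow of this statement.)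
[cite: Hartshorne1977, III Ex. 6.9 (b) (p. 239)] [cite: Fulton1998, §15.1 (with App. B.8.3 (iii))] -/
theorem chCoh_laxMonad (hH : Hartshorne1977_eulerChar_resolution_shortExact.{0})
    {𝓐 𝓚 E 𝓑 𝓙 𝓒 𝓠 : A.X.left.Modules} (a : 𝓐 ⟶ 𝓚) (b : 𝓚 ⟶ E) (hab : a ≫ b = 0)
    (h₁ : (ShortComplex.mk a b hab).ShortExact) (k' : 𝓚 ⟶ 𝓑) (d : 𝓑 ⟶ 𝓙) (hkd : k' ≫ d = 0)
    (h₂ : (ShortComplex.mk k' d hkd).ShortExact) (j : 𝓙 ⟶ 𝓒) (g : 𝓒 ⟶ 𝓠) (hjg : j ≫ g = 0)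
    (h₃ : (ShortComplex.mk j g hjg).ShortExact)
    (c𝓐 : Coh 𝓐) (c𝓚 : Coh 𝓚) (cE : Coh E) (c𝓑 : Coh 𝓑) (c𝓙 : Coh 𝓙) (c𝓒 : Coh 𝓒) (c𝓠 : Coh 𝓠)
    (R𝓐 : StrictlyPerfectResolution 𝓐) (R𝓚 : StrictlyPerfectResolution 𝓚) (RE : StrictlyPerfectResolution E)
    (R𝓑 : StrictlyPerfectResolution 𝓑) (R𝓙 : StrictlyPerfectResolution 𝓙) (R𝓒 : StrictlyPerfectResolution 𝓒)
    (R𝓠 : StrictlyPerfectResolution 𝓠) (k : ℕ) :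
    chCoh C A.X E RE k = chCoh C A.X 𝓑 R𝓑 k - chCoh C A.X 𝓐 R𝓐 k - chCoh C A.X 𝓒 R𝓒 k + chCoh C A.X 𝓠 R𝓠 k := by
  have e₁ := A.chCoh_shortExact C hH (S := ShortComplex.mk a b hab) h₁ c𝓐 c𝓚 cE R𝓐 R𝓚 RE k
  have e₂ := A.chCoh_shortExact C hH (S := ShortComplex.mk k' d hkd) h₂ c𝓚 c𝓑 c𝓙 R𝓚 R𝓑 R𝓙 k
  have e₃ := A.chCoh_shortExact C hH (S := ShortComplex.mk j g hjg) h₃ c𝓙 c𝓒 c𝓠 R𝓙 R𝓒 R𝓠 k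
  simp only at e₁ e₂ e₃
  rw [e₂, e₁, e₃]
  abel

/-- **WINDOW AGREEMENT**: if `ch_p(coker q) = 0` for every `p ∈ I`, then in the window the display sheaf has the DESIGN class
`ch_p(E) = ch_p(𝓑) − ch_p(𝓐) − ch_p(𝓒)`. [cite: Hartshorne1977, III Ex. 6.9 (b) (p. 239)] -/
theorem chCoh_laxMonad_window (hH : Hartshorne1977_eulerChar_resolution_shortExact.{0})
    {𝓐 𝓚 E 𝓑 𝓙 𝓒 𝓠 : A.X.left.Modules} (a : 𝓐 ⟶ 𝓚) (b : 𝓚 ⟶ E) (hab : a ≫ b = 0)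
    (h₁ : (ShortComplex.mk a b hab).ShortExact) (k' : 𝓚 ⟶ 𝓑) (d : 𝓑 ⟶ 𝓙) (hkd : k' ≫ d = 0)
    (h₂ : (ShortComplex.mk k' d hkd).ShortExact) (j : 𝓙 ⟶ 𝓒) (g : 𝓒 ⟶ 𝓠) (hjg : j ≫ g = 0)
    (h₃ : (ShortComplex.mk j g hjg).ShortExact)
    (c𝓐 : Coh 𝓐) (c𝓚 : Coh 𝓚) (cE : Coh E) (c𝓑 : Coh 𝓑) (c𝓙 : Coh 𝓙) (c𝓒 : Coh 𝓒) (c𝓠 : Coh 𝓠)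
    (R𝓐 : StrictlyPerfectResolution 𝓐) (R𝓚 : StrictlyPerfectResolution 𝓚) (RE : StrictlyPerfectResolution E)
    (R𝓑 : StrictlyPerfectResolution 𝓑) (R𝓙 : StrictlyPerfectResolution 𝓙) (R𝓒 : StrictlyPerfectResolution 𝓒)
    (R𝓠 : StrictlyPerfectResolution 𝓠) {I : Finset ℕ} (h𝓠 : ∀ p ∈ I, chCoh C A.X 𝓠 R𝓠 p = 0) :
    ∀ p ∈ I, chCoh C A.X E RE p = chCoh C A.X 𝓑 R𝓑 p - chCoh C A.X 𝓐 R𝓐 p - chCoh C A.X 𝓒 R𝓒 p := by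
  intro p hp
  rw [chCoh_laxMonad C A hH a b hab h₁ k' d hkd h₂ j g hjg h₃ c𝓐 c𝓚 cE c𝓑 c𝓙 c𝓒 c𝓠 R𝓐 R𝓚 RE R𝓑 R𝓙 R𝓒 R𝓠 p,
    h𝓠 p hp, add_zero]

variable {C} {E₀ : AbelianVariety ℂ} {ψ₀ : E₀ ⟶ E₀}

/-- **(A1@Z)ᶜ OF A DEGENERATE MONAD'S DISPLAY SHEAF FROM ITS VIRTUAL DATUM**: on `S⁴`, if the virtual class
`p ↦ ch_p(𝓑) − ch_p(𝓐) − ch_p(𝓒)` is (A1)-clean in the window `I` with `W`-coordinate `μ` (e.g. from the letter kits of a clean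
design, v4 `RealisesTensor`) and `ch(coker q)|_I = 0`, then the display sheaf `E` passes (A1@Z)ᶜ in the window with the SAME
`μ`. [cite: Hartshorne1977, III Ex. 6.9 (b) (p. 239)] -/
theorem cleanAtSeedCoh_of_laxMonad (hH : Hartshorne1977_eulerChar_resolution_shortExact.{0})
    {𝓐 𝓚 E 𝓑 𝓙 𝓒 𝓠 : (pad4Anchor E₀).X.left.Modules} (a : 𝓐 ⟶ 𝓚) (b : 𝓚 ⟶ E) (hab : a ≫ b = 0)
    (h₁ : (ShortComplex.mk a b hab).ShortExact) (k' : 𝓚 ⟶ 𝓑) (d : 𝓑 ⟶ 𝓙) (hkd : k' ≫ d = 0)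
    (h₂ : (ShortComplex.mk k' d hkd).ShortExact) (j : 𝓙 ⟶ 𝓒) (g : 𝓒 ⟶ 𝓠) (hjg : j ≫ g = 0)
    (h₃ : (ShortComplex.mk j g hjg).ShortExact)
    (c𝓐 : Coh 𝓐) (c𝓚 : Coh 𝓚) (cE : Coh E) (c𝓑 : Coh 𝓑) (c𝓙 : Coh 𝓙) (c𝓒 : Coh 𝓒) (c𝓠 : Coh 𝓠)
    (R𝓐 : StrictlyPerfectResolution 𝓐) (R𝓚 : StrictlyPerfectResolution 𝓚) (RE : StrictlyPerfectResolution E)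
    (R𝓑 : StrictlyPerfectResolution 𝓑) (R𝓙 : StrictlyPerfectResolution 𝓙) (R𝓒 : StrictlyPerfectResolution 𝓒)
    (R𝓠 : StrictlyPerfectResolution 𝓠) {I : Finset ℕ} (h4 : 4 ∈ I)
    (h𝓠 : ∀ p ∈ I, chCoh C (pad4Anchor E₀).X 𝓠 R𝓠 p = 0)
    {F : WeilFrame E₀ ψ₀} {h : complexBetti (pad4Anchor E₀).X 2} {μ : GaussianInt}
    (hvirt : ∃ (c : ℕ → ℚ) (q : ℚ),
      (∀ p ∈ I, p ≠ 4 → chCoh C (pad4Anchor E₀).X 𝓑 R𝓑 p - chCoh C (pad4Anchor E₀).X 𝓐 R𝓐 p -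
          chCoh C (pad4Anchor E₀).X 𝓒 R𝓒 p = ((c p : ℚ) : ℂ) • cupPowTwo h p) ∧
      chCoh C (pad4Anchor E₀).X 𝓑 R𝓑 4 - chCoh C (pad4Anchor E₀).X 𝓐 R𝓐 4 - chCoh C (pad4Anchor E₀).X 𝓒 R𝓒 4 =
        ((q : ℚ) : ℂ) • cupPowTwo h 4 + F.wOf μ) :
    CleanAtSeedCoh C I F h E RE μ := by
  have hw := chCoh_laxMonad_window C (pad4Anchor E₀) hH a b hab h₁ k' d hkd h₂ j g hjg h₃ c𝓐 c𝓚 cE c𝓑 c𝓙 c𝓒 c𝓠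
    R𝓐 R𝓚 RE R𝓑 R𝓙 R𝓒 R𝓠 h𝓠
  obtain ⟨c, q', hc, hq⟩ := hvirt
  exact ⟨c, q', fun p hp hp4 => by rw [hw p hp, hc p hp hp4], by rw [hw 4 h4, hq]⟩

end Presentation

/-! ## §20 v20 (g19, 2026-08-30) — ADDITIVE: the TWO-TERM (cokernel) presentation at the coherent door — C5ᶜ for free (the cone
resolution), (A1@Z)ᶜ ⟸ C0 + the side realisations (no hypothesis on `𝓔`: LAW LF does not bite here), C7ᶜ = `I`-semiregularity of the
two-term complex `[𝓟 → 𝓝]` in the window `[−1, 0]` (the ONLY object-side clause), consistency with the vector-bundle door, the split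
screen by name. No declaration of §19.1–§19.4 is changed. -/

section VTwenty

/-! ### §20.1 Coherent realisation predicates (the dictionary on a resolution) -/

section CohRealisation

variable {E₀ : AbelianVariety ℂ} {ψ₀ : E₀ ⟶ E₀} {C : ChernCharacterBetti} {Φ : WordFrame E₀}

/-- **«THE COHERENT SHEAF `𝓕`, READ ON THE RESOLUTION `R`, REALISES THE TENSOR `T`»**: `ch_p(𝓕) = Σ_{wdeg w = p} T(w)·cls p w` for
`p = 0, …, 8`, with `ch_p(𝓕) := chCoh C S⁴ 𝓕 R p` (the Chern character of the class `[𝓕] = Σ (−1)ⁱ [R.Pⁱ] ∈ K₀(S⁴)`). The coherent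
form of v4's `RealisesTensor` (which reads `C.ch`, meaningful on vector bundles only — FLAG F19-1). [cite: Fulton1998, §15.1] -/
def RealisesTensorCoh (C : ChernCharacterBetti) (Φ : WordFrame E₀) (𝓕 : (pad4Anchor E₀).X.left.Modules)
    (R : StrictlyPerfectResolution 𝓕) (T : CWord → GaussianInt) : Prop :=
  ∀ p : Fin 9, chCoh C (pad4Anchor E₀).X 𝓕 R p = Φ.classOf p T

/-- on the trivial resolution `𝓕[0]` of a vector bundle, `RealisesTensorCoh` IS v4's `RealisesTensor` (`chCoh_ofFiniteLocallyFree`).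
[cite: Fulton1998, §15.1 and Example 3.2.3] -/
theorem realisesTensorCoh_ofFiniteLocallyFree_iff {𝓕 : (pad4Anchor E₀).X.left.Modules} (h𝓕 : IsFiniteLocallyFree 𝓕)
    (T : CWord → GaussianInt) :
    RealisesTensorCoh C Φ 𝓕 (StrictlyPerfectResolution.ofFiniteLocallyFree h𝓕) T ↔ RealisesTensor C Φ 𝓕 T := by
  simp only [RealisesTensorCoh, RealisesTensor, chCoh_ofFiniteLocallyFree]

/-- **THE COHERENT DICTIONARY PREDICATE «(`𝓔`, `R`) realises the design `D`»** ((design json, coherent presentation) ↦ `Prop`): `D` is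
(A1)-clean and `ch_p(𝓔) = (c_p(D)∕p!)·h^p` for `p ≤ 8`, `p ≠ 4`, `ch₄(𝓔) = (c₄(D)∕24)·h⁴ + wOf μ(D)`, where `ch_p(𝓔) := chCoh C S⁴ 𝓔 R p`.
The coherent form of v4's `Design.RealisedBy`; its degree-`4` clause is the class half of (σ) AT THE SEED (the `W`-coordinate of `ch₄` of
the presented sheaf is `μ(D)`). [cite: BuchweitzFlenner2003, §5 Thm. 5.1 (hypothesis «α_p(0) = ch_p(ℰ_0)»)] [cite: Fulton1998, §15.1] -/
def Design.RealisedByCoh (D : Design) (C : ChernCharacterBetti) (F : WeilFrame E₀ ψ₀) (h : complexBetti (pad4Anchor E₀).X 2)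
    (𝓔 : (pad4Anchor E₀).X.left.Modules) (R : StrictlyPerfectResolution 𝓔) : Prop :=
  D.Clean ∧
    (∀ p : Fin 9, (p : ℕ) ≠ 4 →
      chCoh C (pad4Anchor E₀).X 𝓔 R p = ((((D.coeff p : ℤ) : ℚ) / ((p : ℕ).factorial : ℚ) : ℚ) : ℂ) • cupPowTwo h p) ∧
    chCoh C (pad4Anchor E₀).X 𝓔 R 4 = ((((D.coeff 4 : ℤ) : ℚ) / 24 : ℚ) : ℂ) • cupPowTwo h 4 + F.wOf D.mu

/-- on the trivial resolution of a vector bundle, `RealisedByCoh` IS v4's `RealisedBy`. [cite: Fulton1998, §15.1 and Example 3.2.3] -/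
theorem Design.realisedByCoh_ofFiniteLocallyFree_iff {D : Design} {F : WeilFrame E₀ ψ₀} {h : complexBetti (pad4Anchor E₀).X 2}
    {𝓔 : (pad4Anchor E₀).X.left.Modules} (h𝓔 : IsFiniteLocallyFree 𝓔) :
    D.RealisedByCoh C F h 𝓔 (StrictlyPerfectResolution.ofFiniteLocallyFree h𝓔) ↔ D.RealisedBy C F h 𝓔 := by
  simp only [Design.RealisedByCoh, Design.RealisedBy, chCoh_ofFiniteLocallyFree]

/-- `RealisedByCoh` ⟺ `RealisedBy` whenever the chosen resolution computes `C.ch 𝓔` (e.g. `chCoh_resolution_eq_ch` below, or any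
resolution under Hartshorne III 6.9 (b) via `AbelianVariety.chCoh_eq`). -/
theorem Design.realisedByCoh_iff_realisedBy_of_chCoh_eq {D : Design} {F : WeilFrame E₀ ψ₀} {h : complexBetti (pad4Anchor E₀).X 2}
    {𝓔 : (pad4Anchor E₀).X.left.Modules} {R : StrictlyPerfectResolution 𝓔}
    (heq : ∀ k, chCoh C (pad4Anchor E₀).X 𝓔 R k = C.ch (pad4Anchor E₀).X 𝓔 k) :
    D.RealisedByCoh C F h 𝓔 R ↔ D.RealisedBy C F h 𝓔 := by
  simp only [Design.RealisedByCoh, Design.RealisedBy, heq]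

/-- **THE COLLAPSE, COHERENT**: a coherent presentation realising the tensor of an (A1)-clean design REALISES THE DESIGN (through any word
frame linked to `(h, r₁, r₂)`; v4's `Design.classOf_wch_of_ne_four ∕ _four`). -/
theorem Design.realisedByCoh_of_realisesTensorCoh {D : Design} {F : WeilFrame E₀ ψ₀} {h : complexBetti (pad4Anchor E₀).X 2}
    {𝓔 : (pad4Anchor E₀).X.left.Modules} {R : StrictlyPerfectResolution 𝓔} (hΦ : Φ.LinksTo F h) (hD : D.Clean)
    (hR : RealisesTensorCoh C Φ 𝓔 R D.wch) : D.RealisedByCoh C F h 𝓔 R :=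
  ⟨hD, fun p hp => (hR p).trans (D.classOf_wch_of_ne_four hΦ hD p hp), (hR 4).trans (D.classOf_wch_four hΦ hD)⟩

/-- **a coherently realised (A1)-clean design is (A1)-clean AT THE SEED** ((A1@Z)ᶜ of §19.3) in every window `I ⊆ {0, …, 8}`. -/
theorem cleanAtSeedCoh_of_realisedByCoh {D : Design} {F : WeilFrame E₀ ψ₀} {h : complexBetti (pad4Anchor E₀).X 2}
    {𝓔 : (pad4Anchor E₀).X.left.Modules} {R : StrictlyPerfectResolution 𝓔} {I : Finset ℕ} (hI : ∀ p ∈ I, p ≤ 8)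
    (hR : D.RealisedByCoh C F h 𝓔 R) : CleanAtSeedCoh C I F h 𝓔 R D.mu := by
  refine ⟨fun p => if hp : p < 9 then ((D.coeff ⟨p, hp⟩ : ℤ) : ℚ) / ((p.factorial : ℕ) : ℚ) else 0,
    ((D.coeff 4 : ℤ) : ℚ) / 24, fun p hpI hp4 => ?_, hR.2.2⟩
  have hp : p < 9 := Nat.lt_succ_of_le (hI p hpI)
  simp only [dif_pos hp]
  exact hR.2.1 ⟨p, hp⟩ hp4

end CohRealisation

/-! ### §20.2 The two-term (cokernel) presentation with NO hypothesis on `𝓔`; its cone resolution; `ch(𝓔) = ch(𝓝) − ch(𝓟)` -/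

section TwoTerm

variable {E₀ : AbelianVariety ℂ} {ψ₀ : E₀ ⟶ E₀} {C : ChernCharacterBetti} {Φ : WordFrame E₀} {D : Design}
  {𝓔 : (pad4Anchor E₀).X.left.Modules}

/-- **THE CONE OF `P• → E[0]` LIVES ONE DEGREE LOWER THAN `P•`**: for `0 → F₁ → E → F₃ → 0` short exact with `E` finite locally free and a
resolution `R` of `F₁` with `R.P` in degrees `≥ a` (`a ≤ 1`), the cone resolution `R.cone` of `F₃` has its complex in degrees `≥ a − 1`
(`Cone(ψ)ⁱ ≅ Pⁱ⁺¹ ⊞ E[0]ⁱ`, Mathlib `CochainComplex.mappingCone.isZero_X_iff`). [cite: Fulton1998, App. B.8.3 (iii)] -/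
theorem cone_isStrictlyGE {Y : Scheme.{0}} {S : ShortComplex Y.Modules} (hS : S.ShortExact) (hE : IsFiniteLocallyFree S.X₂)
    (R : StrictlyPerfectResolution S.X₁) (a : ℤ) [R.P.IsStrictlyGE a] (ha : a ≤ 1) : (R.cone hS hE).P.IsStrictlyGE (a - 1) := by
  rw [StrictlyPerfectResolution.cone_P, CochainComplex.isStrictlyGE_iff]
  intro i hi
  rw [CochainComplex.mappingCone.isZero_X_iff]
  exact ⟨R.P.isZero_of_isStrictlyGE a (i + 1) (by omega),
    HomologicalComplex.isZero_single_obj_X (ComplexShape.up ℤ) 0 S.X₂ i (by omega)⟩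

/-- **A TWO-TERM (COKERNEL) PRESENTATION OF `𝓔` BY THE DESIGN `D`, COHERENT FORM** — the UP display `0 → 𝓟 →φ 𝓝 → 𝓔' ≅ 𝓔 → 0` with `𝓟`, `𝓝`
FINITE LOCALLY FREE, `𝓟` realising `T_P(D)` and `𝓝` realising `T_N(D)` in the word frame — and NOTHING asked of `𝓔 = coker φ` (compare
v4's `CokernelPresentation`, which needs `IsVectorBundle 𝓔'`). The datum the cell's presenters produce (an injective map of letter
bundles). [cite: Fulton1998, App. B.8.3 (iii)] -/
structure CokernelPresentationCoh (C : ChernCharacterBetti) (Φ : WordFrame E₀) (D : Design)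
    (𝓔 : (pad4Anchor E₀).X.left.Modules) where
  /-- `0 → 𝓟 → 𝓝 → 𝓔' → 0` -/
  S : ShortComplex (pad4Anchor E₀).X.left.Modules
  shortExact : S.ShortExact
  /-- `𝓔' ≅ 𝓔` -/
  iso : S.X₃ ≅ 𝓔
  isFiniteLocallyFree₁ : IsFiniteLocallyFree S.X₁
  isFiniteLocallyFree₂ : IsFiniteLocallyFree S.X₂
  /-- `𝓟` realises `T_P(D)` -/
  realisesP : RealisesTensor C Φ S.X₁ D.wchP
  /-- `𝓝` realises `T_N(D)` -/
  realisesN : RealisesTensor C Φ S.X₂ D.wchN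

/-- every v4 (vector-bundle) cokernel presentation is a coherent one (`𝓝` is a vector bundle as an extension of vector bundles,
`Motives.isFiniteLocallyFree_of_shortExact`). [cite: Hartshorne1977, II Ex. 5.7 (b)] -/
def CokernelPresentation.toCoh (π : CokernelPresentation C Φ D 𝓔) : CokernelPresentationCoh C Φ D 𝓔 :=
  ⟨π.S, π.shortExact, π.iso, π.isVectorBundle₁.isFiniteLocallyFree,
    isFiniteLocallyFree_of_shortExact π.shortExact π.isVectorBundle₁.isFiniteLocallyFree π.isVectorBundle₃.isFiniteLocallyFree,
    π.realisesP, π.realisesN⟩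

namespace CokernelPresentationCoh

variable (π : CokernelPresentationCoh C Φ D 𝓔)

/-- **C5ᶜ FOR FREE — THE RESOLUTION OF A TWO-TERM DATUM**: the cone resolution of `𝓔' = coker(𝓟 ↪ 𝓝)` on the trivial resolution `𝓟[0]`
of `𝓟` (its complex is the two-term complex `[𝓟 →φ 𝓝]` in degrees `−1, 0`, as Mathlib's mapping cone of `φ[0] : 𝓟[0] → 𝓝[0]`),
transported along `𝓔' ≅ 𝓔`. No hypothesis on `S⁴` or on `𝓔`. [cite: Fulton1998, App. B.8.3 (iii)] -/
def resolution : StrictlyPerfectResolution 𝓔 :=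
  ((StrictlyPerfectResolution.ofFiniteLocallyFree π.isFiniteLocallyFree₁).cone π.shortExact π.isFiniteLocallyFree₂).ofIso π.iso

/-- the resolving complex is the mapping cone of `φ[0] : 𝓟[0] → 𝓝[0]` (by construction). [cite: Fulton1998, App. B.8.3 (iii)] -/
theorem resolution_P : π.resolution.P = CochainComplex.mappingCone
    ((StrictlyPerfectResolution.ofFiniteLocallyFree π.isFiniteLocallyFree₁).augComp π.S.f) := rfl

/-- **`ch_k(𝓔) = ch_k(𝓝) − ch_k(𝓟)` ON THE CONE RESOLUTION** — fact-free (`chCoh_cone`, `chCoh_ofFiniteLocallyFree`).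
[cite: Fulton1998, §15.1 (with App. B.8.3 (iii))] -/
theorem chCoh_resolution (k : ℕ) :
    chCoh C (pad4Anchor E₀).X 𝓔 π.resolution k = C.ch (pad4Anchor E₀).X π.S.X₂ k - C.ch (pad4Anchor E₀).X π.S.X₁ k := by
  change chCoh C (pad4Anchor E₀).X π.S.X₃ ((StrictlyPerfectResolution.ofFiniteLocallyFree π.isFiniteLocallyFree₁).cone
    π.shortExact π.isFiniteLocallyFree₂) k = _
  rw [chCoh_cone, chCoh_ofFiniteLocallyFree]

/-- a two-term datum realises `T(D) = T_N(D) − T_P(D)` COHERENTLY, on its cone resolution. -/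
theorem realisesTensorCoh_resolution : RealisesTensorCoh C Φ 𝓔 π.resolution D.wch := fun p => by
  rw [π.chCoh_resolution, Design.wch_eq_wchN_sub_wchP, map_sub, π.realisesN p, π.realisesP p]

/-- **(A1@Z)ᶜ ⟸ (A1) + THE TWO SIDE REALISATIONS, two-term door**: a two-term datum of an (A1)-clean design REALISES THE DESIGN
coherently on its cone resolution. No exactness beyond the short exact sequence, no local freeness of `𝓔`. -/
theorem realisedByCoh {F : WeilFrame E₀ ψ₀} {h : complexBetti (pad4Anchor E₀).X 2} (hΦ : Φ.LinksTo F h) (hD : D.Clean) :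
    D.RealisedByCoh C F h 𝓔 π.resolution :=
  Design.realisedByCoh_of_realisesTensorCoh hΦ hD π.realisesTensorCoh_resolution

/-- … hence passes (A1@Z)ᶜ (`CleanAtSeedCoh` of §19.3) in every window `I ⊆ {0, …, 8}` — FLAG F20-1: for a two-term datum the
(A1@Z)ᶜ clause of the coherent checker is IMPLIED by C0. -/
theorem cleanAtSeedCoh {F : WeilFrame E₀ ψ₀} {h : complexBetti (pad4Anchor E₀).X 2} (hΦ : Φ.LinksTo F h) (hD : D.Clean)
    {I : Finset ℕ} (hI : ∀ p ∈ I, p ≤ 8) : CleanAtSeedCoh C I F h 𝓔 π.resolution D.mu :=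
  cleanAtSeedCoh_of_realisedByCoh hI (π.realisedByCoh hΦ hD)

/-- **ON A VECTOR BUNDLE `𝓔` THE CONE RESOLUTION COMPUTES `C.ch 𝓔` ITSELF** (fact-free: `ch_shortExact` on `0 → 𝓟 → 𝓝 → 𝓔' → 0`, all
three vector bundles, and `ch_congr`). [cite: Fulton1998, Example 3.2.3 and §15.1] -/
theorem chCoh_resolution_eq_ch (h𝓔 : IsFiniteLocallyFree 𝓔) (k : ℕ) :
    chCoh C (pad4Anchor E₀).X 𝓔 π.resolution k = C.ch (pad4Anchor E₀).X 𝓔 k := by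
  rw [π.chCoh_resolution, C.ch_shortExact π.S π.shortExact π.isFiniteLocallyFree₁.isVectorBundle
    (isFiniteLocallyFree_of_iso π.iso.symm h𝓔).isVectorBundle k, add_sub_cancel_left]
  exact C.ch_congr π.iso k

/-- on a vector bundle `𝓔`, coherent realisation on the cone resolution IS v4's `RealisedBy`. -/
theorem realisedByCoh_iff_realisedBy (h𝓔 : IsFiniteLocallyFree 𝓔) {F : WeilFrame E₀ ψ₀} {h : complexBetti (pad4Anchor E₀).X 2} :
    D.RealisedByCoh C F h 𝓔 π.resolution ↔ D.RealisedBy C F h 𝓔 :=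
  Design.realisedByCoh_iff_realisedBy_of_chCoh_eq (π.chCoh_resolution_eq_ch h𝓔)

/-! ### §20.3 C7ᶜ for a two-term datum: `I`-semiregularity of the complex `[𝓟 → 𝓝]` in the window `[−1, 0]` -/

/-- the two-term complex lives in degrees `≥ −1` (`𝓟[0]` in degrees `≥ 0`, `cone_isStrictlyGE`). [cite: Fulton1998, App. B.8.3 (iii)] -/
theorem isStrictlyGE_resolution : π.resolution.P.IsStrictlyGE (-1) := by
  haveI : π.resolution.P.IsStrictlyGE (0 - 1) := cone_isStrictlyGE π.shortExact π.isFiniteLocallyFree₂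
    (StrictlyPerfectResolution.ofFiniteLocallyFree π.isFiniteLocallyFree₁) 0 zero_le_one
  exact CochainComplex.isStrictlyGE_of_ge _ (-1) (0 - 1) (by norm_num)

/-- **C7ᶜ FOR A TWO-TERM DATUM — BF `I`-SEMIREGULARITY OF THE TWO-TERM COMPLEX `[𝓟 → 𝓝]` ITSELF** (Chern-degree window `I`, form degrees
`{q | q + 1 ∈ I}`, amplitude window `[−1, 0]`, Mathlib's standard derived category): the components `(σ_q)_{q+1 ∈ I}` of the
semiregularity map of the perfect complex `[𝓟 → 𝓝] ≃ 𝓔` are jointly injective on `Hom_{D(S⁴)}([𝓟→𝓝], [𝓟→𝓝][2]) = Ext²(𝓔, 𝓔)`. A PREDICATE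
on (design json, presentation); nothing asserted. [cite: BuchweitzFlenner2003, Def. 4.1 and §5 (I-semiregular)] -/
def IsSemiregular (I : Finset ℕ) : Prop :=
  letI := HasDerivedCategory.standard (pad4Anchor E₀).X.left.Modules
  haveI := π.isStrictlyGE_resolution
  Literature.AlgebraicGeometry.HodgeTheory.HomComplex.IsISemiregularC (pad4Anchor E₀).X π.resolution.P (-1) 0
    π.resolution.isBoundedVB.isFiniteLocallyFree {q | q + 1 ∈ I}

/-- **IT IS v19's C7ᶜ CLAUSE ON THE CONE RESOLUTION** (`IsBFSemiregularVia`, window-independence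
`HomComplex.isISemiregularC_iff_of_window`). [cite: BuchweitzFlenner2003, §5 (I-semiregular)] -/
theorem isBFSemiregularVia_resolution_iff (I : Finset ℕ) :
    IsBFSemiregularVia (pad4Anchor E₀).X π.resolution I ↔ π.IsSemiregular I := by
  letI := HasDerivedCategory.standard (pad4Anchor E₀).X.left.Modules
  haveI := π.isStrictlyGE_resolution
  constructor
  · rintro ⟨a, ha, h⟩
    exact (Literature.AlgebraicGeometry.HodgeTheory.HomComplex.isISemiregularC_iff_of_window (pad4Anchor E₀).X
      π.resolution.P a 0 (-1) 0 π.resolution.isBoundedVB.isFiniteLocallyFree {q | q + 1 ∈ I}).2 h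
  · intro h
    exact ⟨-1, π.isStrictlyGE_resolution, h⟩

/-- **CONSISTENCY WITH THE VECTOR-BUNDLE DOOR**: if `𝓔` happens to be finite locally free, C7ᶜ of the two-term complex IS v4's
module-level `IsISemiregular h𝓔 _` (transport along the augmentation quasi-isomorphism `[𝓟 → 𝓝] → 𝓔[0]`,
`HomComplex.isISemiregularC_iff_of_quasiIso'`, then `HomComplex.isISemiregularC_single₀_iff`). [cite: BuchweitzFlenner2003, §5 (I-semiregular)] -/
theorem isSemiregular_iff_isISemiregular (h𝓔 : IsFiniteLocallyFree 𝓔) (I : Finset ℕ) :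
    π.IsSemiregular I ↔ IsISemiregular h𝓔 {q | q + 1 ∈ I} := by
  letI := HasDerivedCategory.standard (pad4Anchor E₀).X.left.Modules
  haveI := π.isStrictlyGE_resolution
  have hK : ∀ p, IsFiniteLocallyFree
      ((Literature.AlgebraicGeometry.HodgeTheory.HomComplex.single₀ (pad4Anchor E₀).X.left 𝓔).X p) :=
    (StrictlyPerfectResolution.ofFiniteLocallyFree h𝓔).isBoundedVB.isFiniteLocallyFree
  rw [← Literature.AlgebraicGeometry.HodgeTheory.HomComplex.isISemiregularC_single₀_iff (pad4Anchor E₀).X 𝓔 h𝓔 hK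
    {q | q + 1 ∈ I}]
  -- the augmentation `ε : [𝓟 → 𝓝] ⟶ 𝓔[0]` is a quasi-isomorphism (structure field, passed explicitly: its codomain is
  -- `(singleFunctor _ 0).obj 𝓔`, definitionally `single₀ _ 𝓔`)
  exact @Literature.AlgebraicGeometry.HodgeTheory.HomComplex.isISemiregularC_iff_of_quasiIso' _ _ (pad4Anchor E₀).X _ _ _
    (-1) 0 0 0 _ _ _ _ π.resolution.isBoundedVB.isFiniteLocallyFree hK π.resolution.ε π.resolution.quasiIso {q | q + 1 ∈ I}

end CokernelPresentationCoh

/-! ### §20.4 The two-term seed checker; soundness; «(A1@Z)ᶜ is implied» as an iff; the leaf; agreement with v4 on vector bundles -/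

/-- **THE TWO-TERM SEED CHECKER — a predicate on (design json, presentation = a two-term datum `π`)**: C0′ (`Clean ∧ μ ≠ 0`);
`4 ∈ I ⊆ {0, …, 8}`; and ONE object-side clause, C7ᶜ `π.IsSemiregular I`. C5ᶜ is the TYPE of `π` (its cone resolution exists by
construction); (A1@Z)ᶜ ∕ the class half of (σ) are OMITTED because IMPLIED (`Design.twoTermSeedCheck_iff`); (pad4) ∕ (d = 1) in the types. -/
def Design.TwoTermSeedCheck (D : Design) (C : ChernCharacterBetti) (I : Finset ℕ) (W : WordKit E₀ ψ₀)
    {𝓔 : (pad4Anchor E₀).X.left.Modules} (π : CokernelPresentationCoh C W.Φ D 𝓔) : Prop :=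
  D.ClassDataRankFree ∧ 4 ∈ I ∧ (∀ p ∈ I, p ≤ 8) ∧ π.IsSemiregular I

/-- **SOUNDNESS: a passing (design, two-term datum) pair passes v19's COHERENT checker on the cone resolution.** -/
theorem Design.coherentSheafSeedCheck_of_twoTermSeedCheck (W : WordKit E₀ ψ₀) {I : Finset ℕ}
    {π : CokernelPresentationCoh C W.Φ D 𝓔} (h : D.TwoTermSeedCheck C I W π) :
    D.CoherentSheafSeedCheck C I W.kit 𝓔 π.resolution :=
  ⟨h.1, h.2.1, (π.isBFSemiregularVia_resolution_iff I).2 h.2.2.2, π.cleanAtSeedCoh W.links h.1.1 h.2.2.1⟩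

/-- **FLAG F20-1 AS AN IFF: for `I ⊆ {0, …, 8}` the two-term checker IS v19's coherent checker on the cone resolution** — the (A1@Z)ᶜ
clause of `CoherentSheafSeedCheck` carries no information beyond C0 for a two-term datum; C7ᶜ is the only object-side content. -/
theorem Design.twoTermSeedCheck_iff (W : WordKit E₀ ψ₀) {I : Finset ℕ} (π : CokernelPresentationCoh C W.Φ D 𝓔)
    (hI : ∀ p ∈ I, p ≤ 8) : D.TwoTermSeedCheck C I W π ↔ D.CoherentSheafSeedCheck C I W.kit 𝓔 π.resolution :=
  ⟨fun h => D.coherentSheafSeedCheck_of_twoTermSeedCheck W h,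
    fun h => ⟨h.1, h.2.1, hI, (π.isBFSemiregularVia_resolution_iff I).1 h.2.2.1⟩⟩

/-- **THE LEAF: a passing (design, two-term datum) pair gives a hyperbolic seed of the coherent class at level `4` for `ℚ(i)`.**
[cite: BuchweitzFlenner2003, §5 Thm. 5.1 (hypotheses)] [cite: vanGeemen1994HodgeAV, 5.2–5.4] -/
theorem hasHyperbolicSeedOn_of_twoTermSeedCheck (hE : E₀.dim = 1) (hψ : ψ₀ ≫ ψ₀ = -(1 • 𝟙 E₀)) (W : WordKit E₀ ψ₀)
    {I : Finset ℕ} {π : CokernelPresentationCoh C W.Φ D 𝓔} (h : D.TwoTermSeedCheck C I W π) :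
    HasHyperbolicSeedOn (cohSheafClass C) 4 1 :=
  hasHyperbolicSeedOn_of_coherentSheafSeedCheck hE hψ (D.coherentSheafSeedCheck_of_twoTermSeedCheck W h)

/-- **… + REFEREED coherent BF ⟹ `HasLocallyAlgebraicWeilAnchor 4 1`.** HC ∕ HC_AV ∕ 18881 ∕ H2 NOT proved: no pair is shown to pass.
[cite: BuchweitzFlenner2003, §5 Thm. 5.1] -/
theorem hasLocallyAlgebraicWeilAnchor_four_one_of_BFcoherent_of_twoTermSeedCheck
    (hBF : BuchweitzFlenner2003_variationalHodge_ISemiregular_coherent) (hE : E₀.dim = 1) (hψ : ψ₀ ≫ ψ₀ = -(1 • 𝟙 E₀))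
    (W : WordKit E₀ ψ₀) {I : Finset ℕ} {π : CokernelPresentationCoh C W.Φ D 𝓔} (h : D.TwoTermSeedCheck C I W π) :
    HasLocallyAlgebraicWeilAnchor 4 1 :=
  hasLocallyAlgebraicWeilAnchor_four_one_of_BFcoherent_of_coherentSheafSeedCheck hBF hE hψ
    (D.coherentSheafSeedCheck_of_twoTermSeedCheck W h)

/-- **AGREEMENT WITH v4 ON VECTOR BUNDLES (fact-free)**: if `𝓔` is finite locally free, the two-term checker IS v4's rank-free sheaf
checker `Design.SheafSeedCheckRankFree` (C7ᶜ = `IsISemiregular h𝓔`, `isSemiregular_iff_isISemiregular`; (A1@Z) from `ch_shortExact`). -/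
theorem Design.twoTermSeedCheck_iff_sheafSeedCheckRankFree (W : WordKit E₀ ψ₀) {I : Finset ℕ}
    (π : CokernelPresentationCoh C W.Φ D 𝓔) (h𝓔 : IsFiniteLocallyFree 𝓔) :
    D.TwoTermSeedCheck C I W π ↔ D.SheafSeedCheckRankFree C I W.kit 𝓔 := by
  constructor
  · rintro ⟨hC0, h4, hI, hsr⟩
    exact ⟨hC0, h4, hI, ⟨h𝓔, (π.isSemiregular_iff_isISemiregular h𝓔 I).1 hsr⟩,
      (π.realisedByCoh_iff_realisedBy h𝓔).1 (π.realisedByCoh W.links hC0.1)⟩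
  · rintro ⟨hC0, h4, hI, ⟨h𝓔', hsr⟩, -⟩
    exact ⟨hC0, h4, hI, (π.isSemiregular_iff_isISemiregular h𝓔' I).2 hsr⟩

end TwoTerm

/-! ### §20.5 The split screen, by name (LAW RS at the refereed door) -/

section SplitScreen

universe w

/-- **THE SPLIT SCREEN (necessary conditions for C7ᶜ of a split model, PROVED tree lemmas of `HomComplexSigmaDinatural.lean` §3,
conjoined by name)**: if a strictly perfect model `K₁• ⊞ K₂•` (window `[a, b]`) is `I`-semiregular, then the cross blocks
`Ext²(K₁•, K₂•) = Hom_D(Q K₁•, (Q K₂•)[2])` and `Ext²(K₂•, K₁•)` VANISH and each summand is `I`-semiregular. Reading for the cell's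
RS rooms (`𝓔_φ = ⊕ L_res ⊕ 𝓠_φ'`, complex `[𝓟 → 𝓝'] ⊞ (⊕ L_res)[0]`): C7ᶜ needs `Ext²(L_i, L_j) = H²(L_j ⊗ L_i^∨) = 0` (`i ≠ j`),
`Ext²(L_i, 𝓠) = 0 = Ext²(𝓠, L_i)`, every `L_i` and `𝓠` semiregular — else the datum FAILS C7ᶜ, by name.
[cite: BuchweitzFlenner2003, Cor. 4.8 (consequence) and §5 (I-semiregular)] -/
theorem splitScreen {X₀ : SchemeOver ℂ} [HasDerivedCategory.{w} X₀.left.Modules]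
    {K₁ K₂ : CochainComplex X₀.left.Modules ℤ} (a b : ℤ)
    [K₁.IsStrictlyGE a] [K₁.IsStrictlyLE b] [K₂.IsStrictlyGE a] [K₂.IsStrictlyLE b]
    [(K₁ ⊞ K₂).IsStrictlyGE a] [(K₁ ⊞ K₂).IsStrictlyLE b]
    (hK₁ : ∀ p, IsFiniteLocallyFree (K₁.X p)) (hK₂ : ∀ p, IsFiniteLocallyFree (K₂.X p))
    (hK : ∀ p, IsFiniteLocallyFree ((K₁ ⊞ K₂).X p)) {I : Set ℕ}
    (h : Literature.AlgebraicGeometry.HodgeTheory.HomComplex.IsISemiregularC X₀ (K₁ ⊞ K₂) a b hK I) :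
    (∀ y : ShiftedHom (DerivedCategory.Q.obj K₁) (DerivedCategory.Q.obj K₂) (2 : ℤ), y = 0) ∧
      (∀ y : ShiftedHom (DerivedCategory.Q.obj K₂) (DerivedCategory.Q.obj K₁) (2 : ℤ), y = 0) ∧
      Literature.AlgebraicGeometry.HodgeTheory.HomComplex.IsISemiregularC X₀ K₁ a b hK₁ I ∧
      Literature.AlgebraicGeometry.HodgeTheory.HomComplex.IsISemiregularC X₀ K₂ a b hK₂ I :=
  ⟨fun y => Literature.AlgebraicGeometry.HodgeTheory.HomComplex.IsISemiregularC.eq_zero_of_biprod₁₂ X₀ a b hK hK₂ h y,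
    fun y => Literature.AlgebraicGeometry.HodgeTheory.HomComplex.IsISemiregularC.eq_zero_of_biprod₂₁ X₀ a b hK hK₁ h y,
    Literature.AlgebraicGeometry.HodgeTheory.HomComplex.IsISemiregularC.biprod_fst X₀ a b hK hK₁ h,
    Literature.AlgebraicGeometry.HodgeTheory.HomComplex.IsISemiregularC.biprod_snd X₀ a b hK hK₂ h⟩

variable {E₀ : AbelianVariety ℂ} {ψ₀ : E₀ ⟶ E₀} {C : ChernCharacterBetti} {Φ : WordFrame E₀} {D : Design}
  {𝓔 : (pad4Anchor E₀).X.left.Modules}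

/-- **TRANSPORT OF C7ᶜ TO A SPLIT MODEL**: if the two-term complex `[𝓟 → 𝓝]` of the datum is ISOMORPHIC (as a complex) to a direct sum
`K₁• ⊞ K₂•` in the window `[−1, 0]`, C7ᶜ of the datum is `I`-semiregularity of `K₁• ⊞ K₂•` (`HomComplex.IsISemiregularC.of_iso`), to which
`splitScreen` applies. (For a quasi-isomorphic model use `HomComplex.isISemiregularC_iff_of_quasiIso'` instead.)
[cite: BuchweitzFlenner2003, §5 (I-semiregular)] -/
theorem CokernelPresentationCoh.IsSemiregular.of_iso_biprod (π : CokernelPresentationCoh C Φ D 𝓔)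
    {K₁ K₂ : CochainComplex (pad4Anchor E₀).X.left.Modules ℤ}
    [K₁.IsStrictlyGE (-1)] [K₁.IsStrictlyLE 0] [K₂.IsStrictlyGE (-1)] [K₂.IsStrictlyLE 0]
    (hK₁ : ∀ p, IsFiniteLocallyFree (K₁.X p)) (hK₂ : ∀ p, IsFiniteLocallyFree (K₂.X p)) (e : π.resolution.P ≅ K₁ ⊞ K₂)
    {I : Finset ℕ} (h : π.IsSemiregular I) :
    letI := HasDerivedCategory.standard (pad4Anchor E₀).X.left.Modules
    haveI := Literature.AlgebraicGeometry.HodgeTheory.HomComplex.isStrictlyGE_biprod K₁ K₂ (-1)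
    haveI := Literature.AlgebraicGeometry.HodgeTheory.HomComplex.isStrictlyLE_biprod K₁ K₂ 0
    Literature.AlgebraicGeometry.HodgeTheory.HomComplex.IsISemiregularC (pad4Anchor E₀).X (K₁ ⊞ K₂) (-1) 0
      (Literature.AlgebraicGeometry.HodgeTheory.HomComplex.isFiniteLocallyFree_biprod_X (pad4Anchor E₀).X hK₁ hK₂)
      {q | q + 1 ∈ I} := by
  letI := HasDerivedCategory.standard (pad4Anchor E₀).X.left.Modules
  haveI := Literature.AlgebraicGeometry.HodgeTheory.HomComplex.isStrictlyGE_biprod K₁ K₂ (-1)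
  haveI := Literature.AlgebraicGeometry.HodgeTheory.HomComplex.isStrictlyLE_biprod K₁ K₂ 0
  haveI := π.isStrictlyGE_resolution
  exact Literature.AlgebraicGeometry.HodgeTheory.HomComplex.IsISemiregularC.of_iso (pad4Anchor E₀).X (-1) 0
    (Literature.AlgebraicGeometry.HodgeTheory.HomComplex.isFiniteLocallyFree_biprod_X (pad4Anchor E₀).X hK₁ hK₂)
    π.resolution.isBoundedVB.isFiniteLocallyFree e.symm h

end SplitScreen

end VTwenty


end Summit.HodgeConjecture.HodgeConjecture.Cruxes.BlochSeedDiscOne.SeedChecker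

end
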